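import Summits.NavierStokesRegularity.NavierStokesRegularity.Theses.RellichScar
import Literature.Analysis.FluidPDE.LocalTypeISlabProfile
import Literature.Analysis.FluidPDE.LocalTypeICharacterization
import Literature.Analysis.FluidPDE.LocalTypeILiouville
import Literature.Analysis.FluidPDE.PineauVicolRSS
import Literature.Analysis.FluidPDE.LocalLeraySolutions
import Literature.Analysis.FluidPDE.KinematicApexWitness

/-!
# Disproof of `SymmetricScarExists` (stmt-NavierStokesRegularity-11718) — standing disprover, gen 3

Work file of the crux disprover (cdisprove; gen 2 = §1–§6, gen 3 = §7–§10) for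
`Summit.NavierStokesRegularity.NavierStokesRegularity.Theses.RellichScar.SymmetricScarExists`
(route RellichScar, card Z "one-slice selection").  Prose lives in docstrings only.

## Findings

LANDED through the gate (all sorry-free, axioms ⊆ {propext, Classical.choice, Quot.sound}):
`Literature/Analysis/FluidPDE/LocalTypeISlabProfile.lean` (p69179, §1) and, under
`Theorems/SymmetricScarExists/Negative/`, `LocalTypeIBarrier.lean` (p69923, §2–§3),
`SpiralWorld.lean` (p69717, §4), `RepairedAssembly.lean` (p70228, §4), `SpiralField.lean` (p70278,
§5), `LoadBearingSingularAntecedent.lean` (p70527, §6), `RdssWall.lean` (p70866, §4 bridge);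
gen 3 proposed `ConclusionLoadBearing.lean` (p71687, §7), `TargetCostume.lean` (p71696, §8),
`SelectionSkeleton.lean` (p71705, §9).

* VERDICT (unchanged through three generations): NO KILL is possible without a breakthrough — `¬S`
  EXHIBITS a singular apex Type-I profile, i.e. a witness of the registered OPEN statement
  `LocalTypeISingularityExists` (§1–§2), expected false under KNSS (L); `S` is vacuously TRUE in the
  (L)-world and FALSE in the literature-consistent "spiral world" (§4).  The disproof perimeter is
  therefore the load-bearing / costume / skeleton analysis below, all of it checked Lean.
* §1 PACKAGING: a suitable weak solution on the slab `ℝ³ × (−∞,0)` with a weak gradient,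
  `𝐈(ℝ³ × ℝ₋) < ∞` and a backward-singular origin is — after normalising the pressure to mean zero on
  `B(0,1)` — a LOCAL TYPE I SINGULAR POINT in the printed sense of Albritton–Barker 2019, hence a
  witness of `LocalTypeISingularityExists` (A–B Thm 1.1, first bullet).  No Type-I decay is used.
* §2 BARRIER CERTIFICATE: `¬ SymmetricScarExists → LocalTypeISingularityExists` and
  `¬ LocalTypeISingularityExists → SymmetricScarExists`; the same for the target `NoApexTypeIProfile`
  and for EVERY sibling item quantifying over a singular profile: all eight are corollaries of
  `¬ LocalTypeISingularityExists`.
* §3 KNSS LANGUAGE: modulo the named fact `AlbrittonBarkerForward` a refutation of the crux yields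
  `NontrivialMildAncientTypeIExists`; adding (L), the witness must have a NON-measurable slice.
* §4 THE OMITTED SYMMETRY CLASS (Pineau–Vicol 2026, Perelman's rotated self-similar ansatz, Conj.
  1.1 OPEN for `α ≈ 1`): on `α`-RSS fields the crux's two alternatives COINCIDE and the scar is a
  log-SPIRAL; CONDITIONAL REFUTATION `not_symmetricScarExists_of_spiral_world`; REPAIR
  `SymmetricScarExistsSpiral` with the third Fatal `RssApexFatal α` and the repaired assembly PROVED
  sound; BRIDGE to the tree's Tsai–Perelman wall (`RotatedTypeIDSSLiouville`): in that direction the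
  crux's fate IS the wall.
* §5 KINEMATIC SPIRAL COUNTEREXAMPLE: `‖x‖⁻¹ χ(‖x‖/√−t) R(−2α log‖x‖) e₁` has the Type-I bound, a
  singular origin, is `α`-RSS, has a spiral scar and NEITHER a homogeneous NOR an axisymmetric scar.
* §6 LOAD-BEARING (antecedent): dropping the singularity from the ANTECEDENT turns the crux into a
  construction of a Type-I singularity — FALSE in the (L)-world where the crux is TRUE.
* §7 LOAD-BEARING (conclusion, gen 3): dropping the SINGULARITY from the conclusion makes `S` TRUE
  outright (zero flow); dropping ONLY the NAVIER–STOKES membership from the conclusion makes `S` TRUE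
  outright — the sibling's kinematic parabolic bump (weak gradient, `𝐈 < ⊤`, decay `3`, singular) has a
  support shrinking into the origin, hence ZERO scar, hence BOTH scar symmetries (and it is exactly
  self-similar); the sibling support `NoMildScar` is likewise false without the equations; the
  conclusion's decay is NOT load-bearing relative to (L).  Net: the conclusion is non-trivial exactly
  through "Navier–Stokes ∧ singular", the antecedent's own perimeter.
* §8 COSTUME (gen 3, gen-1 evidence now landed): under the route's own `ScarRigidity` +
  `SimilarityCovariance` + the two Fatal supports the conclusion of `S` is NEVER instantiated, so
  `S ↔ X` (target); in any world with an apex profile `¬(S ∧ ScarRigidity)`.  Every line for `S` that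
  does not refute `ScarRigidity` is a line for `X`.
* §9 SELECTION SKELETON (gen 3): "compact space + continuous zoom flow + commuting circle action ⇒ a
  point fixed by one of them" is FALSE (translations on `ℝ/ℤ`); inside the crux the counterexample is
  the scar orbit of an RSS field, on which the zoom flow is periodic
  (`sameScar_nsRescale_mul_period_of_isSpiralRSS`).  Engines need a minimality-breaking input.
* §11 NORMAL FORMS (gen 3): `pos_const_of_decay_singular` (a singular profile has `C > 0`),
  `symmetricScarExists_iff_exists`, `symmetricScarExists_iff_pos`.
* §10 REMARKS: pointers to the sibling `ScarRigidity` seat's linear analysis (exterior Rellich lemma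
  dead by potential flows; OU spectral gap ⇒ no generic linear kill), the CGL rotating-blow-up analogy
  for §4, the small-constant corner, full `SO(3)` covariance.
* RESISTS BECAUSE: `¬S` needs (i) a singular apex Type-I profile (= `LocalTypeISingularityExists`,
  open, believed false; no junk member: essential-sup singularity, honest distributional class —
  gen 1 audit + four route-pass refuters + §7's confirmation that only "NSE ∧ singular" carries
  content) AND (ii) the absence of any symmetric-scar profile.  The sharpest literature-consistent
  scenario delivering both is the spiral world of §4 (realised kinematically in §5); its non-emptiness
  is Perelman's problem (P–V Conj. 1.1) in the unexpected direction.  Toy dynamics do not bear on the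
  existential consequent unless `ScarRigidity` is granted (§8: then `S ↔ X`).

Evidence trail: gen-1 sections (costume `S ↔ (ApexExists → SymScarWitness)`, `X → S`, `C ≤ 0`
vacuity, zero-flow / kinematic-envelope junk witnesses, Bool×Bool selection skeleton, zero-scar
shortcut) live in the item's evidence notes (files not mounted on this hub); §7–§9 re-found and
strengthen the ones worth importing.
-/

noncomputable section

open MeasureTheory Set Function Filter Topology TopologicalSpace Metric
open scoped NNReal ENNReal

namespace Summit.NavierStokesRegularity.NavierStokesRegularity.Cruxes.SymmetricScarExists.Disproof

open Literature.Analysis.FluidPDE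
open Summit.NavierStokesRegularity.NavierStokesRegularity.Theses.RellichScar

set_option linter.dupNamespace false

/-- Local notation for physical space `ℝ³ = EuclideanSpace ℝ (Fin 3)`. -/
local notation "ℝ³" => EuclideanSpace ℝ (Fin 3)

/-- Local notation for the open backward slab `(-∞, 0) × ℝ³` (time first). -/
local notation "𝕊" => slab (EuclideanSpace ℝ (Fin 3)) (Iio (0 : ℝ)) isOpen_Iio

/-! ## §1 Packaging: slab profiles with `𝐈 < ∞` and a singular origin are local Type I singular points

LANDED (p69179, 2026-08-15T22:58Z, commit dfcd3d875447) as
`Literature/Analysis/FluidPDE/LocalTypeISlabProfile.lean`, imported above: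
`Literature.Analysis.FluidPDE.isLocalTypeISingularPoint_of_slabProfile` — a suitable weak solution on
the slab with a weak gradient, `𝐈(ℝ³ × ℝ₋) < ∞` and a backward-singular origin is, with the pressure
normalised to mean zero on `B(0,1)`, a local Type I singular point in Albritton–Barker's printed sense
(`IsLocalTypeISingularPoint 1 0 u (p − [p]_{B(0,1)})`; no Type-I decay used), and
`Literature.Analysis.FluidPDE.localTypeISingularityExists_of_slabProfile` — hence a witness of the
registered OPEN statement `LocalTypeISingularityExists` (helpers `parabolicCylinder_subset_slab`,
`parabolicCylinderOpens_le_slab`, `ae_integrableOn_slice_of_locallyIntegrableOn_slab`,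
`memLp_mean_of_compact`). -/

/-! ## §2 Barrier certificate: the crux, the target and six siblings versus `LocalTypeISingularityExists` -/

section Barrier

/-- **Refuting the crux constructs a Type-I singularity.**  `¬ SymmetricScarExists` yields the
antecedent's singular apex profile, which §1 packages into `LocalTypeISingularityExists`.
[cite: AlbrittonBarker2019, Thm 1.1] -/
theorem localTypeISingularityExists_of_not_symmetricScarExists (h : ¬ SymmetricScarExists) :
    LocalTypeISingularityExists := by
  by_contra hno
  refine h fun C hex => ?_
  obtain ⟨u, p, G, hsw, hwg, hI, -, hsing⟩ := hex
  exact absurd (localTypeISingularityExists_of_slabProfile hsw hwg hI hsing) hno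

/-- **The crux holds in the (L)-world**: if no suitable weak solution has a local Type I singular
point (`¬ LocalTypeISingularityExists`, e.g. under the Liouville conjecture via A–B Thm 1.1), then
`SymmetricScarExists` holds — vacuously, its antecedent class being empty. [cite: AlbrittonBarker2019, §1] -/
theorem symmetricScarExists_of_not_localTypeISingularityExists (hno : ¬ LocalTypeISingularityExists) :
    SymmetricScarExists := by
  by_contra h
  exact hno (localTypeISingularityExists_of_not_symmetricScarExists h)

/-- The route's TARGET `X = NoApexTypeIProfile` is likewise a corollary of
`¬ LocalTypeISingularityExists` (the apex decay is not even needed). [cite: AlbrittonBarker2019, Thm 1.1] -/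
theorem noApexTypeIProfile_of_not_localTypeISingularityExists (hno : ¬ LocalTypeISingularityExists) :
    NoApexTypeIProfile :=
  fun _ _ _ _ hsw hwg hI _ hsing => hno (localTypeISingularityExists_of_slabProfile hsw hwg hI hsing)

/-- Conversely a failure of the target is a Type-I singularity in the A–B sense. [cite: AlbrittonBarker2019, Thm 1.1] -/
theorem localTypeISingularityExists_of_not_noApexTypeIProfile (h : ¬ NoApexTypeIProfile) :
    LocalTypeISingularityExists := by
  by_contra hno
  exact h (noApexTypeIProfile_of_not_localTypeISingularityExists hno)

/-- Sibling crux `ScarRigidity` (stmt-11717) is a corollary of `¬ LocalTypeISingularityExists`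
(its hypotheses contain a singular slab profile with `𝐈 < ∞`). [cite: AlbrittonBarker2019, Thm 1.1] -/
theorem scarRigidity_of_not_localTypeISingularityExists (hno : ¬ LocalTypeISingularityExists) :
    ScarRigidity :=
  fun _ _ _ _ _ _ _ hs₁ hg₁ hI₁ _ _ _ _ _ hsing₁ _ _ =>
    absurd (localTypeISingularityExists_of_slabProfile hs₁ hg₁ hI₁ hsing₁) hno

/-- Sibling crux `ApexLocalisation` (stmt-11719) is a corollary of `¬ LocalTypeISingularityExists`
(its antecedent is a singular RATE-class slab profile with `𝐈 < ∞`; the rate is not needed either).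
[cite: AlbrittonBarker2019, Thm 1.1] -/
theorem apexLocalisation_of_not_localTypeISingularityExists (hno : ¬ LocalTypeISingularityExists) :
    ApexLocalisation := by
  intro C hex
  obtain ⟨u, p, G, hsw, hwg, hI, -, hsing⟩ := hex
  exact absurd (localTypeISingularityExists_of_slabProfile hsw hwg hI hsing) hno

/-- Support `SimilarityCovariance` (stmt-11720) is a corollary of `¬ LocalTypeISingularityExists`.
[cite: AlbrittonBarker2019, Thm 1.1] -/
theorem similarityCovariance_of_not_localTypeISingularityExists (hno : ¬ LocalTypeISingularityExists) :
    SimilarityCovariance :=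
  fun _ _ _ _ hsw hwg hI _ hsing =>
    absurd (localTypeISingularityExists_of_slabProfile hsw hwg hI hsing) hno

/-- Support `SelfSimilarApexFatal` (stmt-11721) is a corollary of `¬ LocalTypeISingularityExists`.
[cite: AlbrittonBarker2019, Thm 1.1] -/
theorem selfSimilarApexFatal_of_not_localTypeISingularityExists (hno : ¬ LocalTypeISingularityExists) :
    SelfSimilarApexFatal :=
  fun _ _ _ _ hsw hwg hI _ hsing _ => hno (localTypeISingularityExists_of_slabProfile hsw hwg hI hsing)

/-- Support `AxisymmetricApexFatal` (stmt-11722) is a corollary of `¬ LocalTypeISingularityExists`.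
[cite: AlbrittonBarker2019, Thm 1.1] -/
theorem axisymmetricApexFatal_of_not_localTypeISingularityExists (hno : ¬ LocalTypeISingularityExists) :
    AxisymmetricApexFatal :=
  fun _ _ _ _ hsw hwg hI _ hsing _ => hno (localTypeISingularityExists_of_slabProfile hsw hwg hI hsing)

/-- Support `NoMildScar` (stmt-11723) is a corollary of `¬ LocalTypeISingularityExists`.
[cite: AlbrittonBarker2019, Thm 1.1] -/
theorem noMildScar_of_not_localTypeISingularityExists (hno : ¬ LocalTypeISingularityExists) :
    NoMildScar :=
  fun _ _ _ _ hsw hwg hI _ hsing _ _ _ _ _ =>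
    hno (localTypeISingularityExists_of_slabProfile hsw hwg hI hsing)

/-- **Summary of §2.**  The eight items of route RellichScar that quantify over a singular slab
profile — target, the three non-shared cruxes and four supports — are JOINTLY implied by the single
statement `¬ LocalTypeISingularityExists` (negation of A–B Thm 1.1's first bullet, the registered
open statement other Type-I routes attack directly, e.g. `TypeICertificateLadder`), and the failure
of either the crux or the target implies that bullet. [cite: AlbrittonBarker2019, Thm 1.1] -/
theorem route_newItems_of_not_localTypeISingularityExists (hno : ¬ LocalTypeISingularityExists) :
    NoApexTypeIProfile ∧ ScarRigidity ∧ SymmetricScarExists ∧ ApexLocalisation ∧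
      SimilarityCovariance ∧ SelfSimilarApexFatal ∧ AxisymmetricApexFatal ∧ NoMildScar :=
  ⟨noApexTypeIProfile_of_not_localTypeISingularityExists hno,
    scarRigidity_of_not_localTypeISingularityExists hno,
    symmetricScarExists_of_not_localTypeISingularityExists hno,
    apexLocalisation_of_not_localTypeISingularityExists hno,
    similarityCovariance_of_not_localTypeISingularityExists hno,
    selfSimilarApexFatal_of_not_localTypeISingularityExists hno,
    axisymmetricApexFatal_of_not_localTypeISingularityExists hno,
    noMildScar_of_not_localTypeISingularityExists hno⟩

end Barrier

/-! ## §3 The same barrier in KNSS language: Type-I blow-up profiles and the Liouville conjecture (L) -/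

section KNSS

/-- **Refuting the crux produces a KNSS Type-I blow-up profile** (modulo the forward half of
Albritton–Barker 2019, Thm 1.1, vendored as the named fact `AlbrittonBarkerForward`): a non-trivial
mild bounded ancient solution with `𝐈 < ∞` (`NontrivialMildAncientTypeIExists`, the registered OPEN
second bullet of A–B Thm 1.1 — "In principle, constructing ancient solutions with Type I decay is a
(difficult) route to obtaining Navier–Stokes singularities", A–B §1). [cite: AlbrittonBarker2019, Thm 1.1 and §1] -/
theorem nontrivialMildAncientTypeIExists_of_not_symmetricScarExists (hfwd : AlbrittonBarkerForward)
    (h : ¬ SymmetricScarExists) : NontrivialMildAncientTypeIExists :=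
  hfwd (localTypeISingularityExists_of_not_symmetricScarExists h)

/-- **Under (L), a refutation of the crux can only come with a measurability pathology.**  Assume
the forward half of A–B Thm 1.1 and the Liouville conjecture `LiouvilleConjectureNS` (KNSS 2009:
bounded ancient mild solutions with measurable slices are constant).  Then any refutation of
`SymmetricScarExists` yields a witness `(u, p, G)` of `NontrivialMildAncientTypeIExists` one of whose
slices `u t`, `t < 0`, is NOT a.e.-strongly measurable — the known gap of the accepted duality-form
class `IsBoundedAncientMildSolution` (tree `LocalTypeILiouville.lean`), not a fluid-mechanical
object.  In the (L)-world the crux is therefore refutable only "for the wrong reason", and that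
reason sits two named facts away from the crux (A–B forward; the slice-measurability proviso).
[cite: AlbrittonBarker2019, §1 after Thm 1.1; KNSS2009, §1] -/
theorem exists_nonmeasurable_witness_of_not_symmetricScarExists (hfwd : AlbrittonBarkerForward)
    (hL : LiouvilleConjectureNS) (h : ¬ SymmetricScarExists) :
    ∃ (u : ℝ → ℝ³ → ℝ³) (p : ℝ → ℝ³ → ℝ) (G : ℝ → ℝ³ → ℝ³ →L[ℝ] ℝ³),
      Literature.Analysis.FluidPDE.IsBoundedAncientMildSolution 1 u ∧
      IsSuitableWeakSolutionOn 𝕊 1 0 u p ∧ HasWeakSpatialGradientOn 𝕊 u G ∧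
      ¬ (uncurry u =ᵐ[volume.restrict (Iio (0 : ℝ) ×ˢ (univ : Set ℝ³))] 0) ∧
      typeIBound (Iio (0 : ℝ) ×ˢ (univ : Set ℝ³)) u p G < ∞ ∧
      ∃ t < 0, ¬ AEStronglyMeasurable (u t) volume := by
  obtain ⟨u, p, G, hu, hs, hG, hne, hI⟩ :=
    nontrivialMildAncientTypeIExists_of_not_symmetricScarExists hfwd h
  exact ⟨u, p, G, hu, hs, hG, hne, hI,
    hL.exists_not_aestronglyMeasurable_slice_of_abTypeIBound hu hG hne hI⟩

/-- Contrapositive packaging: (L) + A–B forward + "every bounded ancient mild solution arising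
this way has measurable slices" ⇒ the crux.  The measurability clause is stated as a hypothesis on
the witnesses of `NontrivialMildAncientTypeIExists` (it holds for the KNSS representatives, which
are smooth; the accepted class does not record it). [cite: KNSS2009, §1; AlbrittonBarker2019, §1] -/
theorem symmetricScarExists_of_liouville (hfwd : AlbrittonBarkerForward) (hL : LiouvilleConjectureNS)
    (hmeas : ∀ (u : ℝ → ℝ³ → ℝ³) (p : ℝ → ℝ³ → ℝ) (G : ℝ → ℝ³ → ℝ³ →L[ℝ] ℝ³),
      Literature.Analysis.FluidPDE.IsBoundedAncientMildSolution 1 u →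
      IsSuitableWeakSolutionOn 𝕊 1 0 u p → HasWeakSpatialGradientOn 𝕊 u G →
      typeIBound (Iio (0 : ℝ) ×ˢ (univ : Set ℝ³)) u p G < ∞ →
      ∀ t < 0, AEStronglyMeasurable (u t) volume) :
    SymmetricScarExists := by
  by_contra h
  obtain ⟨u, p, G, hu, hs, hG, -, hI, t, ht, hnot⟩ :=
    exists_nonmeasurable_witness_of_not_symmetricScarExists hfwd hL h
  exact hnot (hmeas u p G hu hs hG hI t ht)

end KNSS

/-! ## §4 The omitted symmetry class: rotated self-similar (Perelman) profiles and spiral scars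

Pineau–Vicol 2026 (arXiv:2607.09619, pp. 3–7; tree `PineauVicolRSS.lean`): besides scaling, the
equations are invariant under rotations; composing gives the ROTATED SELF-SIMILAR (RSS) class
`u(x,t) = λ R(2α log λ) u(λ R(−2α log λ) x, λ² t)` for all `λ > 0` ((1.6)–(1.7), Perelman's ansatz),
whose Type-I members are the subject of the OPEN Conjecture 1.1 (= Tsai GSM 192 Conj. 8.9 =
Bradshaw–Tsai OP 5.2): "In contrast to the non-rotated case (α = 0), it is currently an open problem
to rule out nontrivial rotated backward self-similar singularities" (p. 3); Thm 1.4 settles only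
`|α| < α₁(C)` and `|α| > α₂(C)` (p. 4).  In group form RSS says: the parabolic rescaling by
`λ = e^{−θ/(2α)}` IS the rotation-conjugation by `θ` (`IsSpiralRSS` below).  Consequences proved here:

* for an RSS field the two disjuncts of the crux's conclusion COINCIDE (`HomScar u ↔ AxiScar u`):
  an RSS profile has a homogeneous scar iff it has an axisymmetric scar iff (informally) its far-field
  pattern is `SO(2)`-equivariant.  FAR FIELD OF A TYPE-I RSS PROFILE (informal derivation, not
  formalised; inputs: P–V Lemma 2.1, p. 9: `|∇U| ≤ C/(1+|y|²)`, `|∇²U| ≤ C/(1+|y|³)`,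
  `|P| ≤ C/(1+|y|^{2−σ})`, all `α`-independent, and — by the same singular-integral argument applied
  to `∇(U ⊗ U) = O(|y|⁻³)` — `|∇P| ≤ C/(1+|y|^{3−σ})`):
  (1.8a) reads `½U + αJU + (½y − αJy)·∇U = ΔU − U·∇U − ∇P = O(|y|^{−3+σ})`, a transport equation
  along the LOG-SPIRAL characteristics `ẏ = ½y − αJy` (radial rate `½`, azimuthal rate `−α`);
  integrating, `e^{τ/2} R(ατ) U(y(τ))` converges with rate `O(|y|^{−2+σ})`, i.e.
  `U(y) = |y|⁻¹ R(−2α log|y|) A₀(R(2α log|y|) ŷ) + O(|y|^{−3+σ})` for a continuous pattern `A₀` on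
  `S²`, NON-ZERO for a non-trivial profile (else `U ∈ L³` and ESS kills it, P–V p. 4), and otherwise
  unconstrained at this order (no equivariance is forced).  The scar is then
  `σ(x) = lim_{t↑0} u(x,t) = |x|⁻¹ R(−2α log|x|) A₀(R(2α log|x|) x̂)`: generically NEITHER homogeneous
  NOR axisymmetric, but invariant under the spiral subgroup (`SpiralScar α`, automatic for RSS
  fields, `spiralScar_of_isSpiralRSS`);
* RSS PROFILES BREAK THE ROUTE WHICHEVER THEIR PATTERN: with an equivariant pattern (`AxiScar`, hence
  `HomScar`) a singular apex RSS profile refutes `ScarRigidity` given the two provable supports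
  (`not_scarRigidity_of_rss_axiScar`); with a non-equivariant one it refutes the crux in the spiral
  world below;
* CONDITIONAL REFUTATION (`not_symmetricScarExists_of_spiral_world`): in a world where some singular
  apex profile exists and every singular apex profile is `α`-RSS (one fixed `α ≠ 0`) with a
  non-axisymmetric scar — e.g. the apex class is the symmetry orbit of ONE RSS Type-I profile with
  `α ≈ 1` and a non-equivariant pattern, a world consistent with every Liouville theorem in print
  (Tsai 1998 / NRŠ 1996: `α = 0` only; KNSS 2009 / Seregin–Šverák 2009: axisymmetric only; Chae–Wolf
  2017 and P–V Thm 1.7: DSS factors near `1` only, whereas an `α`-RSS field is DSS with factor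
  `e^{π/|α|} ≈ 23` for `α ≈ 1`, `IsSpiralRSS.dss`; P–V Thm 1.4: extreme `|α|` only) — the crux is
  FALSE, while `ScarRigidity` is consistent there.  So any proof of the crux must exclude this world,
  i.e. prove a form of Perelman's conjecture for non-equivariant patterns; the crux's dichotomy
  "homogeneous OR axisymmetric" omits the third kind of one-parameter subgroup of `ℝ₊ × SO(2)`;
* REPAIR for the planner (`SymmetricScarExistsSpiral`, implied by the crux): add the disjunct
  `∃ α, SpiralScar α u`; the matching third Fatal support is `RssApexFatal α` ("a singular apex
  profile is not a.e. `α`-RSS"; `α = 0` is `SelfSimilarApexFatal`, `rssApexFatal_zero_iff`), i.e.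
  Perelman's Conjecture 1.1 in apex form (open for `α ≈ 1`; tree fact `pineauVicol2026_rss_liouville`
  gives the two ends), and the repaired assembly is PROVED sound: `noApexTypeIProfile_of_repaired :
  ScarRigidity → SymmetricScarExistsSpiral → SimilarityCovariance → (∀ α, RssApexFatal α) →
  AxisymmetricApexFatal → NoApexTypeIProfile`.
-/

section Spiral

variable {u v w : ℝ → ℝ³ → ℝ³}

/-- SAME SCAR (the route's inline rendering, cf. `ScarRigidity`): the essential supremum of
`‖u − v‖` over `(−δ, 0) × K` tends to `0` as `δ ↓ 0`, for every compact `K ∌ 0`. [folklore] -/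
def SameScar (u v : ℝ → ℝ³ → ℝ³) : Prop :=
  ∀ K : Set ℝ³, IsCompact K → (0 : ℝ³) ∉ K →
    Tendsto (fun δ : ℝ => eLpNorm (uncurry u - uncurry v) ⊤
      (volume.restrict (Ioo (-δ) 0 ×ˢ K))) (𝓝[>] 0) (𝓝 0)

/-- Rotation-conjugation about the `x₃`-axis: `(conjZ θ u)(t, x) = R_θ u(t, R_{−θ} x)` (the form used
by the crux, `SimilarityCovariance` and `AxisymmetricApexFatal`). [cite: KNSS2009, §1] -/
def conjZ (θ : ℝ) (u : ℝ → ℝ³ → ℝ³) : ℝ → ℝ³ → ℝ³ := fun t x => rotZ θ (u t (rotZ (-θ) x))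

/-- First disjunct of the crux's conclusion: the scar is (−1)-HOMOGENEOUS (every rescaling has the
same scar). [folklore] -/
def HomScar (u : ℝ → ℝ³ → ℝ³) : Prop := ∀ lam : ℝ, 0 < lam → SameScar (nsRescale lam u) u

/-- Second disjunct: the scar is AXISYMMETRIC about the `x₃`-axis (every rotation-conjugate has the
same scar). [folklore] -/
def AxiScar (u : ℝ → ℝ³ → ℝ³) : Prop := ∀ θ : ℝ, SameScar (conjZ θ u) u

/-- The omitted third alternative: SPIRAL scar with pitch `α` — invariance of the scar under the
one-parameter subgroup `λ ↦ R_{2α log λ} ∘ D_λ` of `ℝ₊ × SO(2)` (`α = 0` is `HomScar`). [cite: PineauVicol2026, §1.2 (1.6)–(1.7)] -/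
def SpiralScar (α : ℝ) (u : ℝ → ℝ³ → ℝ³) : Prop :=
  ∀ lam : ℝ, 0 < lam → SameScar (conjZ (2 * α * Real.log lam) (nsRescale lam u)) u

/-- Readback certificate: the crux is LITERALLY "singular apex profile exists ⇒ one exists with
`HomScar ∨ AxiScar`" (definitional unfolding only). [folklore] -/
theorem symmetricScarExists_iff_homScar_or_axiScar :
    SymmetricScarExists ↔
      ∀ C : ℝ, (∃ (u : ℝ → ℝ³ → ℝ³) (p : ℝ → ℝ³ → ℝ) (G : ℝ → ℝ³ → ℝ³ →L[ℝ] ℝ³),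
        IsSuitableWeakSolutionOn 𝕊 1 0 u p ∧ HasWeakSpatialGradientOn 𝕊 u G ∧
        typeIBound (Iio (0 : ℝ) ×ˢ univ) u p G < ⊤ ∧ HasTypeIDecay C u ∧
        IsBackwardSingularPoint u 0) →
      ∃ (C' : ℝ) (u : ℝ → ℝ³ → ℝ³) (p : ℝ → ℝ³ → ℝ) (G : ℝ → ℝ³ → ℝ³ →L[ℝ] ℝ³),
        IsSuitableWeakSolutionOn 𝕊 1 0 u p ∧ HasWeakSpatialGradientOn 𝕊 u G ∧
        typeIBound (Iio (0 : ℝ) ×ˢ univ) u p G < ⊤ ∧ HasTypeIDecay C' u ∧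
        IsBackwardSingularPoint u 0 ∧ (HomScar u ∨ AxiScar u) :=
  Iff.rfl

/-! ### Algebra of the symmetry group `ℝ₊ × SO(2)` acting on fields -/

/-- `R_{2π} = 1`. [folklore] -/
theorem rotZ_two_pi' (x : ℝ³) : rotZ (2 * Real.pi) x = x := by
  ext i
  fin_cases i <;> simp

/-- `R_{−2π} = 1`. [folklore] -/
theorem rotZ_neg_two_pi (x : ℝ³) : rotZ (-(2 * Real.pi)) x = x := by
  ext i
  fin_cases i <;> simp [Real.cos_neg, Real.sin_neg]

/-- `R_θ (a • y) = a • R_θ y`. [folklore] -/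
theorem rotZ_smul' (θ a : ℝ) (y : ℝ³) : rotZ θ (a • y) = a • rotZ θ y := by
  ext i
  fin_cases i <;> simp <;> ring

/-- `R_θ 0 = 0`. [folklore] -/
theorem rotZ_zero_vec' (θ : ℝ) : rotZ θ (0 : ℝ³) = 0 := by
  simpa using rotZ_smul' θ 0 (0 : ℝ³)

/-- `conjZ 0 = id`. [folklore] -/
theorem conjZ_zero (u : ℝ → ℝ³ → ℝ³) : conjZ 0 u = u := by
  funext t x
  simp [conjZ]

/-- `conjZ θ ∘ conjZ φ = conjZ (θ + φ)` (the rotations about one axis form a one-parameter group).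
[folklore] -/
theorem conjZ_conjZ (θ φ : ℝ) (u : ℝ → ℝ³ → ℝ³) : conjZ θ (conjZ φ u) = conjZ (θ + φ) u := by
  funext t x
  simp only [conjZ]
  rw [rotZ_add, show -(θ + φ) = -φ + -θ by ring, rotZ_add]

/-- Rotation-conjugation commutes with the parabolic rescaling. [folklore] -/
theorem nsRescale_conjZ (c θ : ℝ) (u : ℝ → ℝ³ → ℝ³) :
    nsRescale c (conjZ θ u) = conjZ θ (nsRescale c u) := by
  funext t x
  simp only [conjZ, nsRescale_apply, rotZ_smul']

/-! ### The scar functional under modification on `t < 0` -/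

/-- The scar functional only sees `t < 0`. [folklore] -/
theorem eLpNorm_scar_congr {f g h : ℝ → ℝ³ → ℝ³} (hfg : ∀ t < 0, ∀ x, f t x = g t x) (δ : ℝ)
    (K : Set ℝ³) :
    eLpNorm (uncurry f - uncurry h) ⊤ (volume.restrict (Ioo (-δ) 0 ×ˢ K)) =
      eLpNorm (uncurry g - uncurry h) ⊤ (volume.restrict (Ioo (-δ) 0 ×ˢ K)) := by
  refine eLpNorm_congr_ae ?_
  have h1 : ∀ᵐ z ∂(volume.restrict (Ioo (-δ) (0 : ℝ) ×ˢ (univ : Set ℝ³))),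
      z ∈ Ioo (-δ) (0 : ℝ) ×ˢ (univ : Set ℝ³) :=
    ae_restrict_mem (measurableSet_Ioo.prod MeasurableSet.univ)
  have h2 : ∀ᵐ z ∂(volume.restrict (Ioo (-δ) (0 : ℝ) ×ˢ K)), z ∈ Ioo (-δ) (0 : ℝ) ×ˢ (univ : Set ℝ³) :=
    ae_restrict_of_ae_restrict_of_subset (prod_mono Subset.rfl (subset_univ K)) h1
  filter_upwards [h2] with z hz
  show f z.1 z.2 - h z.1 z.2 = g z.1 z.2 - h z.1 z.2
  rw [hfg z.1 hz.1.2 z.2]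

/-- `SameScar` is invariant under modification of the left field on `t ≥ 0` — indeed under any
modification agreeing on `t < 0`. [folklore] -/
theorem sameScar_congr_left {f g h : ℝ → ℝ³ → ℝ³} (hfg : ∀ t < 0, ∀ x, f t x = g t x) :
    SameScar f h ↔ SameScar g h := by
  unfold SameScar
  simp_rw [eLpNorm_scar_congr hfg]

/-- `SameScar` is reflexive. [folklore] -/
theorem sameScar_refl (u : ℝ → ℝ³ → ℝ³) : SameScar u u := by
  intro K _ _
  simp only [sub_self, eLpNorm_zero]
  exact tendsto_const_nhds

/-! ### RSS in group form and its consequences for the crux's dichotomy -/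

/-- **Rotated self-similarity (Perelman; Pineau–Vicol 2026 (1.6)–(1.7)) in group form**: for every
angle `θ`, the parabolic rescaling by `λ = e^{−θ/(2α)}` coincides on `t < 0` with the
rotation-conjugation by `θ`.  For `α ≠ 0`, as `θ` ranges over `ℝ`, `λ` ranges over all of `(0, ∞)`;
P–V's ansatz (1.7) `u = (−t)^{−1/2} R(αs) U(R(−αs) x/√(−t))`, `s = −log(−t)`, has this property
(`isSpiralRSS_pvAnsatz`). [cite: PineauVicol2026, §1.2 (1.6)–(1.7) (arXiv:2607.09619 p. 3)] -/
def IsSpiralRSS (α : ℝ) (u : ℝ → ℝ³ → ℝ³) : Prop :=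
  ∀ θ : ℝ, ∀ t < 0, ∀ x : ℝ³, nsRescale (Real.exp (-θ / (2 * α))) u t x = conjZ θ u t x

/-- **For an RSS field the crux's two alternatives coincide.**  If `u` is `α`-RSS with `α ≠ 0`,
then `u` has a homogeneous scar iff it has an axisymmetric scar: each rescaling of `u` IS a
rotation-conjugate and vice versa. [cite: PineauVicol2026, §1.2] -/
theorem homScar_iff_axiScar_of_isSpiralRSS {α : ℝ} (hα : α ≠ 0) (h : IsSpiralRSS α u) :
    HomScar u ↔ AxiScar u := by
  constructor
  · intro hH θ
    exact (sameScar_congr_left (h θ)).1 (hH (Real.exp (-θ / (2 * α))) (Real.exp_pos _))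
  · intro hA lam hlam
    set θ : ℝ := -(2 * α) * Real.log lam with hθ
    have hlam' : Real.exp (-θ / (2 * α)) = lam := by
      rw [hθ, show -(-(2 * α) * Real.log lam) / (2 * α) = Real.log lam by field_simp,
        Real.exp_log hlam]
    rw [← hlam']
    exact (sameScar_congr_left (h θ)).2 (hA θ)

/-- **An RSS field is discretely self-similar with factor `e^{π/α}`** (Pineau–Vicol 2026,
Remark 1.5, RSS ⊆ DSS): at `θ = −2π` the conjugation is trivial.  For `α ≈ 1` the factor is
`e^{π} ≈ 23.1`, far outside the near-`1` windows of Chae–Wolf 2017 Thm 1.3 / P–V Thm 1.7.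
[cite: PineauVicol2026, Remark 1.5 (arXiv:2607.09619 p. 5)] -/
theorem IsSpiralRSS.dss {α : ℝ} (h : IsSpiralRSS α u) :
    ∀ t < 0, ∀ x : ℝ³, nsRescale (Real.exp (Real.pi / α)) u t x = u t x := by
  intro t ht x
  have key := h (-(2 * Real.pi)) t ht x
  rw [show -(-(2 * Real.pi)) / (2 * α) = Real.pi / α by ring] at key
  rw [key]
  simp only [conjZ, neg_neg, rotZ_two_pi', rotZ_neg_two_pi]

/-- **RSS fields have spiral scars**, trivially (the spiral subgroup fixes the field itself on
`t < 0`). [cite: PineauVicol2026, §1.2] -/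
theorem spiralScar_of_isSpiralRSS {α : ℝ} (hα : α ≠ 0) (h : IsSpiralRSS α u) : SpiralScar α u := by
  intro lam hlam
  set θ : ℝ := -(2 * α) * Real.log lam with hθ
  have hlam' : Real.exp (-θ / (2 * α)) = lam := by
    rw [hθ, show -(-(2 * α) * Real.log lam) / (2 * α) = Real.log lam by field_simp,
      Real.exp_log hlam]
  have hfun : ∀ t < 0, ∀ x, conjZ (2 * α * Real.log lam) (nsRescale lam u) t x = u t x := by
    intro t ht x
    have key : ∀ y : ℝ³, nsRescale lam u t y = conjZ θ u t y := by
      intro y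
      have hy := h θ t ht y
      rwa [hlam'] at hy
    have e1 : conjZ (2 * α * Real.log lam) (nsRescale lam u) t x =
        conjZ (2 * α * Real.log lam) (conjZ θ u) t x := by
      simp only [conjZ, key]
    rw [e1, conjZ_conjZ, show 2 * α * Real.log lam + θ = 0 by rw [hθ]; ring, conjZ_zero]
  exact (sameScar_congr_left hfun).2 (sameScar_refl u)

/-- At pitch `0` the spiral alternative is the homogeneous one. [folklore] -/
theorem spiralScar_zero_iff : SpiralScar 0 u ↔ HomScar u := by
  unfold SpiralScar HomScar
  simp only [mul_zero, zero_mul, conjZ_zero]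

/-- **The Pineau–Vicol / Perelman ansatz field is RSS in group form** (sanity bridge to the tree's
`pvAnsatz`): for `α ≠ 0` and an `s`-independent profile, `pvAnsatz α U` satisfies `IsSpiralRSS α`
(`√(−λ²t) = λ√(−t)`, `log(−λ²t) = 2 log λ + log(−t)`, `2α log λ = −θ`). [cite: PineauVicol2026, (1.7) and Remark 1.5 (arXiv:2607.09619 pp. 3, 5)] -/
theorem isSpiralRSS_pvAnsatz {α : ℝ} (hα : α ≠ 0) (U : ℝ³ → ℝ³) :
    IsSpiralRSS α (pvAnsatz α (fun y _ => U y)) := by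
  intro θ t ht x
  set c : ℝ := Real.exp (-θ / (2 * α)) with hc
  have hcpos : 0 < c := Real.exp_pos _
  have hnt : 0 < -t := by linarith
  have hs : 0 < Real.sqrt (-t) := Real.sqrt_pos.2 hnt
  have hsqrt : Real.sqrt (-(c ^ 2 * t)) = c * Real.sqrt (-t) := by
    rw [show -(c ^ 2 * t) = c ^ 2 * (-t) by ring, Real.sqrt_mul (sq_nonneg c), Real.sqrt_sq hcpos.le]
  have hlog : Real.log (-(c ^ 2 * t)) = 2 * Real.log c + Real.log (-t) := by
    rw [show -(c ^ 2 * t) = c ^ 2 * (-t) by ring, Real.log_mul (by positivity) hnt.ne',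
      Real.log_pow]
    push_cast
    ring
  have hlogc : Real.log c = -θ / (2 * α) := by rw [hc, Real.log_exp]
  have hangle : α * -Real.log (-(c ^ 2 * t)) = θ + α * -Real.log (-t) := by
    rw [hlog, hlogc]
    field_simp
    ring
  -- left-hand side in normal form
  have eL : nsRescale c (pvAnsatz α (fun y _ => U y)) t x =
      (Real.sqrt (-t))⁻¹ • rotZ (θ + α * -Real.log (-t))
        (U (rotZ (-(θ + α * -Real.log (-t))) ((Real.sqrt (-t))⁻¹ • x))) := by
    rw [nsRescale_apply]
    simp only [pvAnsatz]
    rw [hsqrt, hangle, smul_smul, smul_smul]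
    congr 1
    · field_simp
    · congr 2
      congr 1
      field_simp
  -- right-hand side in normal form
  have eR : conjZ θ (pvAnsatz α (fun y _ => U y)) t x =
      (Real.sqrt (-t))⁻¹ • rotZ (θ + α * -Real.log (-t))
        (U (rotZ (-(θ + α * -Real.log (-t))) ((Real.sqrt (-t))⁻¹ • x))) := by
    simp only [conjZ, pvAnsatz]
    rw [rotZ_smul', ← rotZ_add, rotZ_smul', ← rotZ_add,
      show -(α * -Real.log (-t)) + -θ = -(θ + α * -Real.log (-t)) by ring,
      ← rotZ_smul' (-(θ + α * -Real.log (-t))) (Real.sqrt (-t))⁻¹ x]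
  rw [eL, eR]


/-! ### Bridge to the tree's Type-I RDSS Liouville wall (`RotatedTypeIDSSLiouville`, Tsai–Perelman) -/

/-- Rotation about `e₃` as a linear isometric equivalence (light-import twin of the tree's
`rotZLIE`). -/
def rotZIso (θ : ℝ) : ℝ³ ≃ₗᵢ[ℝ] ℝ³ where
  toFun := rotZ θ
  invFun := rotZ (-θ)
  map_add' x y := by
    ext i
    fin_cases i <;> simp <;> ring
  map_smul' a x := by simp [rotZ_smul']
  left_inv x := by
    show rotZ (-θ) (rotZ θ x) = x
    rw [← rotZ_add, neg_add_cancel, rotZ_zero]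
  right_inv x := by
    show rotZ θ (rotZ (-θ) x) = x
    rw [← rotZ_add, add_neg_cancel, rotZ_zero]
  norm_map' := norm_rotZ θ

/-- `rotZIso θ` acts as `R_θ`. [folklore] -/
@[simp] theorem rotZIso_apply (θ : ℝ) (x : ℝ³) : rotZIso θ x = rotZ θ x := rfl

/-- Its inverse acts as `R_{−θ}`. [folklore] -/
@[simp] theorem rotZIso_symm_apply (θ : ℝ) (x : ℝ³) : (rotZIso θ).symm x = rotZ (-θ) x := rfl

/-- All-time form of the RSS identity (for the Pineau–Vicol ansatz field both sides vanish for
`t ≥ 0`, `isSpiralRSSGlobal_pvAnsatz`); this is the form the tree's `IsRotatedDSS` (all `t`) wants. -/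
def IsSpiralRSSGlobal (α : ℝ) (u : ℝ → ℝ³ → ℝ³) : Prop :=
  ∀ θ t : ℝ, ∀ x : ℝ³, nsRescale (Real.exp (-θ / (2 * α))) u t x = conjZ θ u t x

/-- The all-time identity restricts to the `t < 0` one. [folklore] -/
theorem IsSpiralRSSGlobal.isSpiralRSS {α : ℝ} (h : IsSpiralRSSGlobal α u) : IsSpiralRSS α u :=
  fun θ t _ x => h θ t x

/-- The Pineau–Vicol ansatz field is RSS at all times (junk `0` for `t ≥ 0` on both sides).
[cite: PineauVicol2026, (1.7) (arXiv:2607.09619 p. 3)] -/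
theorem isSpiralRSSGlobal_pvAnsatz {α : ℝ} (hα : α ≠ 0) (U : ℝ³ → ℝ³) :
    IsSpiralRSSGlobal α (pvAnsatz α (fun y _ => U y)) := by
  intro θ t x
  by_cases ht : t < 0
  · exact isSpiralRSS_pvAnsatz hα U θ t ht x
  · push Not at ht
    have hct : 0 ≤ Real.exp (-θ / (2 * α)) ^ 2 * t := mul_nonneg (sq_nonneg _) ht
    have h1 : Real.sqrt (-(Real.exp (-θ / (2 * α)) ^ 2 * t)) = 0 :=
      Real.sqrt_eq_zero'.2 (by linarith)
    have h2 : Real.sqrt (-t) = 0 := Real.sqrt_eq_zero'.2 (by linarith)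
    simp [conjZ, nsRescale_apply, pvAnsatz, h1, h2, rotZ_zero_vec']

/-- **RSS ⊆ RDSS, group form**: an all-time `α`-RSS field is rotated discretely self-similar in
the tree's sense `IsRotatedDSS λ (R_{−2α log λ})` for EVERY factor `λ > 0`
(Pineau–Vicol 2026, Remark 1.5 / §1.4; Chae–Wolf 2017, Def. 1.1). [cite: PineauVicol2026, §1.4 (arXiv:2607.09619 pp. 6–7)] -/
theorem IsSpiralRSSGlobal.isRotatedDSS {α : ℝ} (hα : α ≠ 0) (h : IsSpiralRSSGlobal α u)
    {lam : ℝ} (hlam : 0 < lam) :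
    IsRotatedDSS lam (rotZIso (-(2 * α * Real.log lam))) u := by
  intro t x
  set θ : ℝ := -(2 * α * Real.log lam) with hθ
  have hlam' : Real.exp (-θ / (2 * α)) = lam := by
    rw [hθ, show -(-(2 * α * Real.log lam)) / (2 * α) = Real.log lam by field_simp, Real.exp_log hlam]
  have key := h θ t (rotZ θ x)
  rw [hlam'] at key
  simp only [nsRescale_apply, conjZ] at key
  rw [← rotZ_add, neg_add_cancel, rotZ_zero] at key
  simp only [rotZIso_apply, rotZIso_symm_apply]
  rw [← rotZ_smul', key, ← rotZ_add, neg_add_cancel, rotZ_zero]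

/-- **The RDSS wall empties the spiral world.**  If the tree's rotated Type-I DSS Liouville
statements `RotatedTypeIDSSLiouville c R` hold for all `c`, `R` (the OPEN Tsai–Perelman wall,
`TypeIDSSLiouvilleConjecture`), then every all-time `α`-RSS ancient mild solution with measurable
slices and a Type-I bound vanishes slice-wise (apply the wall with `c = e`, `R = R_{−2α}`).
[cite: PineauVicol2026, Conjecture 1.1; BradshawTsai2017CPDE, §5 OP 5.1] -/
theorem slices_ae_zero_of_rdss_wall {α : ℝ} (hα : α ≠ 0)
    (hwall : ∀ (c : ℝ) (R : ℝ³ ≃ₗᵢ[ℝ] ℝ³), RotatedTypeIDSSLiouville c R)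
    (hmild : Literature.Analysis.FluidPDE.IsAncientMildSolution 1 u)
    (hmeas : ∀ t < 0, AEStronglyMeasurable (u t) volume) (h : IsSpiralRSSGlobal α u) {C : ℝ}
    (hdec : HasTypeIDecay C u) : ∀ t < 0, u t =ᵐ[volume] 0 :=
  hwall (Real.exp 1) (rotZIso (-(2 * α * Real.log (Real.exp 1)))) (Real.one_lt_exp_iff.2 one_pos) u
    hmild hmeas (h.isRotatedDSS hα (Real.exp_pos 1)) ⟨C, hdec⟩

/-- Slice-wise vanishing excludes a backward-singular origin (Tonelli glue, tree
`ae_eq_zero_slab_of_ae_slice`). [folklore] -/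
theorem not_isBackwardSingularPoint_of_slices_ae_zero {G : ℝ → ℝ³ → ℝ³ →L[ℝ] ℝ³}
    (hwg : HasWeakSpatialGradientOn 𝕊 u G) (h0 : ∀ t < 0, u t =ᵐ[volume] 0) :
    ¬ IsBackwardSingularPoint u 0 := by
  intro hs
  have hjoint : AEStronglyMeasurable (uncurry u)
      (volume.restrict (Iio (0 : ℝ) ×ˢ (univ : Set ℝ³))) :=
    hwg.locallyIntegrableOn.aestronglyMeasurable
  have hslice : ∀ᵐ t ∂(volume.restrict (Iio (0 : ℝ))), u t =ᵐ[volume] 0 :=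
    (ae_restrict_mem measurableSet_Iio).mono fun t ht => h0 t ht
  have hz := ae_eq_zero_slab_of_ae_slice hjoint hslice
  have hz' : ∀ᵐ z ∂(volume.restrict (parabolicCylinder 1 (0 : ℝ × ℝ³))), uncurry u z = (0 : ℝ × ℝ³ → ℝ³) z :=
    ae_restrict_of_ae_restrict_of_subset (parabolicCylinder_subset_lowerHalf le_rfl 1) hz
  have h1 := hs 1 one_pos
  rw [eLpNorm_congr_ae hz', eLpNorm_zero] at h1
  exact ENNReal.zero_ne_top h1

/-- **Summary**: under the (open) RDSS wall there is no singular apex profile which is an all-time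
`α`-RSS ancient mild solution with measurable slices — the spiral world of
`not_symmetricScarExists_of_spiral_world` is exactly as empty as the Tsai–Perelman wall says, no
emptier: the crux's fate in that direction IS the wall. [cite: PineauVicol2026, Conjecture 1.1] -/
theorem no_rss_singular_apex_profile_of_rdss_wall {α : ℝ} (hα : α ≠ 0)
    (hwall : ∀ (c : ℝ) (R : ℝ³ ≃ₗᵢ[ℝ] ℝ³), RotatedTypeIDSSLiouville c R)
    {G : ℝ → ℝ³ → ℝ³ →L[ℝ] ℝ³} {C : ℝ}
    (hwg : HasWeakSpatialGradientOn 𝕊 u G) (hdec : HasTypeIDecay C u)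
    (hmild : Literature.Analysis.FluidPDE.IsAncientMildSolution 1 u)
    (hmeas : ∀ t < 0, AEStronglyMeasurable (u t) volume) (h : IsSpiralRSSGlobal α u) :
    ¬ IsBackwardSingularPoint u 0 :=
  not_isBackwardSingularPoint_of_slices_ae_zero hwg (slices_ae_zero_of_rdss_wall hα hwall hmild hmeas h hdec)

/-! ### The spiral world: a literature-consistent scenario in which the crux fails -/

/-- **Conditional refutation (spiral world).**  Suppose (i) some singular apex profile exists and
(ii) for one fixed `α ≠ 0`, EVERY singular apex profile (any constant) is `α`-RSS with a
non-axisymmetric scar.  Then `SymmetricScarExists` is false: a homogeneous-scar witness would be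
RSS, hence axisymmetric-scarred (`homScar_iff_axiScar_of_isSpiralRSS`).  Hypothesis (ii) describes
the symmetry orbit of a single RSS Type-I profile with `α ≈ 1` and a non-`SO(2)`-equivariant
far-field pattern `A₀` (scar `|x|⁻¹ R_{−2α log|x|} A₀(R_{2α log|x|} x̂)`); no Liouville theorem in
print excludes it (P–V 2026 p. 3: open; Conj. 1.1), and `ScarRigidity` is consistent with it
(distinct conjugates have distinct scars).  Hence every proof of the crux proves, in particular,
that this world is empty — a Perelman-type Liouville theorem for non-equivariant patterns.
[cite: PineauVicol2026, Conjecture 1.1 and Theorem 1.4 (arXiv:2607.09619 pp. 3–4)] -/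
theorem not_symmetricScarExists_of_spiral_world {α : ℝ} (hα : α ≠ 0)
    (hex : ∃ (C : ℝ) (u : ℝ → ℝ³ → ℝ³) (p : ℝ → ℝ³ → ℝ) (G : ℝ → ℝ³ → ℝ³ →L[ℝ] ℝ³),
      IsSuitableWeakSolutionOn 𝕊 1 0 u p ∧ HasWeakSpatialGradientOn 𝕊 u G ∧
      typeIBound (Iio (0 : ℝ) ×ˢ univ) u p G < ⊤ ∧ HasTypeIDecay C u ∧
      IsBackwardSingularPoint u 0)
    (hworld : ∀ (C : ℝ) (u : ℝ → ℝ³ → ℝ³) (p : ℝ → ℝ³ → ℝ) (G : ℝ → ℝ³ → ℝ³ →L[ℝ] ℝ³),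
      IsSuitableWeakSolutionOn 𝕊 1 0 u p → HasWeakSpatialGradientOn 𝕊 u G →
      typeIBound (Iio (0 : ℝ) ×ˢ univ) u p G < ⊤ → HasTypeIDecay C u →
      IsBackwardSingularPoint u 0 → IsSpiralRSS α u ∧ ¬ AxiScar u) :
    ¬ SymmetricScarExists := by
  intro hS
  obtain ⟨C, u, p, G, hsw, hwg, hI, hdec, hsing⟩ := hex
  obtain ⟨C', v, q, H, hsw', hwg', hI', hdec', hsing', hsym⟩ :=
    hS C ⟨u, p, G, hsw, hwg, hI, hdec, hsing⟩
  obtain ⟨hRSS, hnotAxi⟩ := hworld C' v q H hsw' hwg' hI' hdec' hsing'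
  rcases hsym with hHom | hAxi
  · exact hnotAxi ((homScar_iff_axiScar_of_isSpiralRSS hα hRSS).1 hHom)
  · exact hnotAxi hAxi


/-- **An RSS singular apex profile with EQUIVARIANT pattern refutes `ScarRigidity`** (given the two
provable supports `SimilarityCovariance`, `SelfSimilarApexFatal`): its scar is axisymmetric, hence
homogeneous (`homScar_iff_axiScar_of_isSpiralRSS`), so `ScarRigidity` identifies the profile with
all its rescalings and Tsai's theorem (inside `SelfSimilarApexFatal`) yields `False`.  Together with
`not_symmetricScarExists_of_spiral_world`: a Type-I RSS profile (Perelman's open scenario, P–V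
Conj. 1.1) sinks the route through `ScarRigidity` if its pattern is equivariant and through the crux
otherwise. [cite: PineauVicol2026, Conjecture 1.1 (arXiv:2607.09619 p. 3)] -/
theorem not_scarRigidity_of_rss_axiScar {α : ℝ} (hα : α ≠ 0) (hCov : SimilarityCovariance)
    (hSS : SelfSimilarApexFatal)
    (hex : ∃ (C : ℝ) (u : ℝ → ℝ³ → ℝ³) (p : ℝ → ℝ³ → ℝ) (G : ℝ → ℝ³ → ℝ³ →L[ℝ] ℝ³),
      IsSuitableWeakSolutionOn 𝕊 1 0 u p ∧ HasWeakSpatialGradientOn 𝕊 u G ∧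
      typeIBound (Iio (0 : ℝ) ×ˢ univ) u p G < ⊤ ∧ HasTypeIDecay C u ∧
      IsBackwardSingularPoint u 0 ∧ IsSpiralRSS α u ∧ AxiScar u) :
    ¬ ScarRigidity := by
  intro hSR
  obtain ⟨C, u, p, G, hsw, hwg, hI, hdec, hsing, hRSS, hAxi⟩ := hex
  have hHom : HomScar u := (homScar_iff_axiScar_of_isSpiralRSS hα hRSS).2 hAxi
  refine hSS u p G C hsw hwg hI hdec hsing fun lam hlam => ?_
  obtain ⟨q, H, hs₁, hg₁, hI₁, hd₁, hsing₁⟩ := (hCov u p G C hsw hwg hI hdec hsing).1 lam hlam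
  exact hSR _ q H u p G C hs₁ hg₁ hI₁ hd₁ hsw hwg hI hdec hsing₁ hsing (hHom lam hlam)

/-! ### The repaired crux for the planner -/

/-- **Repaired crux `S⁺`** (planner-facing): the selection a symmetry engine on the compact set of
singular apex profiles modulo `ℝ₊ × SO(2)` can at best deliver — a profile whose scar is fixed by
SOME one-parameter subgroup: a spiral one (`∃ α, SpiralScar α u`; `α = 0` is the homogeneous case)
or the rotations (`AxiScar u`).  Closing the route with `S⁺` needs a third Fatal support,
"spiral-scar singular apex profiles do not exist", which under `ScarRigidity` is Perelman's
Conjecture (P–V Conj. 1.1, open for `α ≈ 1`). [cite: PineauVicol2026, Conjecture 1.1] -/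
def SymmetricScarExistsSpiral : Prop :=
  ∀ C : ℝ, (∃ (u : ℝ → ℝ³ → ℝ³) (p : ℝ → ℝ³ → ℝ) (G : ℝ → ℝ³ → ℝ³ →L[ℝ] ℝ³),
      IsSuitableWeakSolutionOn 𝕊 1 0 u p ∧ HasWeakSpatialGradientOn 𝕊 u G ∧
      typeIBound (Iio (0 : ℝ) ×ˢ univ) u p G < ⊤ ∧ HasTypeIDecay C u ∧
      IsBackwardSingularPoint u 0) →
    ∃ (C' : ℝ) (u : ℝ → ℝ³ → ℝ³) (p : ℝ → ℝ³ → ℝ) (G : ℝ → ℝ³ → ℝ³ →L[ℝ] ℝ³),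
      IsSuitableWeakSolutionOn 𝕊 1 0 u p ∧ HasWeakSpatialGradientOn 𝕊 u G ∧
      typeIBound (Iio (0 : ℝ) ×ˢ univ) u p G < ⊤ ∧ HasTypeIDecay C' u ∧
      IsBackwardSingularPoint u 0 ∧ ((∃ α : ℝ, SpiralScar α u) ∨ AxiScar u)

/-- The crux implies its repaired form (`HomScar = SpiralScar 0`). [folklore] -/
theorem symmetricScarExistsSpiral_of_symmetricScarExists (hS : SymmetricScarExists) :
    SymmetricScarExistsSpiral := by
  intro C hex
  obtain ⟨C', v, q, H, hsw', hwg', hI', hdec', hsing', hsym⟩ := hS C hex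
  refine ⟨C', v, q, H, hsw', hwg', hI', hdec', hsing', ?_⟩
  rcases hsym with hHom | hAxi
  · exact Or.inl ⟨0, spiralScar_zero_iff.2 hHom⟩
  · exact Or.inr hAxi

/-- **In the spiral world the repaired crux holds while the crux fails**: the RSS profile itself
is a spiral-scar witness (`spiralScar_of_isSpiralRSS`).  So the crux is STRICTLY stronger than what
the card's own engines (monotone / extremal selection modulo symmetries) aim at. [cite: PineauVicol2026, §1.2] -/
theorem symmetricScarExistsSpiral_of_spiral_world {α : ℝ} (hα : α ≠ 0)
    (hworld : ∀ (C : ℝ) (u : ℝ → ℝ³ → ℝ³) (p : ℝ → ℝ³ → ℝ) (G : ℝ → ℝ³ → ℝ³ →L[ℝ] ℝ³),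
      IsSuitableWeakSolutionOn 𝕊 1 0 u p → HasWeakSpatialGradientOn 𝕊 u G →
      typeIBound (Iio (0 : ℝ) ×ˢ univ) u p G < ⊤ → HasTypeIDecay C u →
      IsBackwardSingularPoint u 0 → IsSpiralRSS α u) :
    SymmetricScarExistsSpiral := by
  intro C hex
  obtain ⟨u, p, G, hsw, hwg, hI, hdec, hsing⟩ := hex
  exact ⟨C, u, p, G, hsw, hwg, hI, hdec, hsing,
    Or.inl ⟨α, spiralScar_of_isSpiralRSS hα (hworld C u p G hsw hwg hI hdec hsing)⟩⟩


/-- **The third Fatal support the repaired crux needs** — Perelman's conjecture in apex-class form,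
generalising `SelfSimilarApexFatal` (`α = 0`): a singular apex profile cannot be a.e. `α`-RSS, i.e.
cannot satisfy `R_{2α log λ} D_λ u = u` a.e. on the slab for every `λ > 0`.  OPEN for `α ≈ 1`
(Pineau–Vicol 2026 Conj. 1.1; Thm 1.4 = tree fact `pineauVicol2026_rss_liouville` gives
`|α| < α₁(C)` and `|α| > α₂(C)` for classical RSS solutions). -/
def RssApexFatal (α : ℝ) : Prop :=
  ∀ (u : ℝ → ℝ³ → ℝ³) (p : ℝ → ℝ³ → ℝ) (G : ℝ → ℝ³ → ℝ³ →L[ℝ] ℝ³) (C : ℝ),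
    IsSuitableWeakSolutionOn 𝕊 1 0 u p → HasWeakSpatialGradientOn 𝕊 u G →
    typeIBound (Iio (0 : ℝ) ×ˢ univ) u p G < ⊤ → HasTypeIDecay C u → IsBackwardSingularPoint u 0 →
    (∀ lam : ℝ, 0 < lam →
      uncurry (conjZ (2 * α * Real.log lam) (nsRescale lam u)) =ᵐ[volume.restrict (Iio (0 : ℝ) ×ˢ univ)]
        uncurry u) → False

/-- At pitch `0`, `RssApexFatal 0` is literally `SelfSimilarApexFatal`. [folklore] -/
theorem rssApexFatal_zero_iff : RssApexFatal 0 ↔ SelfSimilarApexFatal := by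
  unfold RssApexFatal
  simp only [mul_zero, zero_mul, conjZ_zero]
  rfl

/-- **The repaired assembly is sound** (planner-facing): `ScarRigidity`, the REPAIRED crux
`SymmetricScarExistsSpiral`, `SimilarityCovariance`, the axisymmetric Fatal support and the spiral
Fatal supports `RssApexFatal α` for all `α` (`α = 0` being `SelfSimilarApexFatal`) imply the target
`NoApexTypeIProfile` — by the same lines as the route's `closes`: a spiral-scar profile has, for each
`λ`, the apex profile `R_{2α log λ} D_λ u` (two uses of covariance) with the same scar, which
`ScarRigidity` identifies with `u`; so `u` is a.e. `α`-RSS and `RssApexFatal α` ends it.  Hence the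
repair costs exactly one new named open problem (Perelman's conjecture in apex form) and nothing
else. [cite: PineauVicol2026, Conjecture 1.1 (arXiv:2607.09619 p. 3)] -/
theorem noApexTypeIProfile_of_repaired (hSR : ScarRigidity) (hZ : SymmetricScarExistsSpiral)
    (hCov : SimilarityCovariance) (hRss : ∀ α : ℝ, RssApexFatal α) (hAx : AxisymmetricApexFatal) :
    NoApexTypeIProfile := by
  intro u p G C hsw hwg hI hdec hsing
  obtain ⟨C', z, pz, Gz, hsz, hgz, hIz, hdz, hsingz, hsym⟩ := hZ C ⟨u, p, G, hsw, hwg, hI, hdec, hsing⟩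
  rcases hsym with ⟨α, hspiral⟩ | hax
  · refine hRss α z pz Gz C' hsz hgz hIz hdz hsingz fun lam hlam => ?_
    -- the rescaled profile, then its rotation-conjugate, stay in the apex class with the same constant
    obtain ⟨q₁, H₁, hs₁, hg₁, hI₁, hd₁, hsing₁⟩ := (hCov z pz Gz C' hsz hgz hIz hdz hsingz).1 lam hlam
    obtain ⟨q₂, H₂, hs₂, hg₂, hI₂, hd₂, hsing₂⟩ :=
      (hCov (nsRescale lam z) q₁ H₁ C' hs₁ hg₁ hI₁ hd₁ hsing₁).2 (2 * α * Real.log lam)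
    exact hSR _ q₂ H₂ z pz Gz C' hs₂ hg₂ hI₂ hd₂ hsz hgz hIz hdz hsing₂ hsingz (hspiral lam hlam)
  · refine hAx z pz Gz C' hsz hgz hIz hdz hsingz fun θ => ?_
    obtain ⟨q₁, H₁, hs₁, hg₁, hI₁, hd₁, hsing₁⟩ := (hCov z pz Gz C' hsz hgz hIz hdz hsingz).2 θ
    exact hSR _ q₁ H₁ z pz Gz C' hs₁ hg₁ hI₁ hd₁ hsz hgz hIz hdz hsing₁ hsingz (hax θ)

end Spiral


/-! ## §5 A kinematic spiral field: the omitted class is non-empty in the Type-I envelope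

Gen 1 showed that the Type-I envelope `C e₃/(‖x‖+√−t)` meets BOTH alternatives of the crux (so,
kinematically, the conclusion is satisfiable).  Here is the complementary kinematic fact: the explicit
log-spiral field `u(t,x) = ‖x‖⁻¹ χ(‖x‖/√−t) R(−2α log‖x‖) e₁` (`χ` a cut-off vanishing for
`‖x‖ ≤ √−t`), which is the `t ↑ 0` shape of a Type-I RSS profile with the non-equivariant pattern
`A₀ ≡ e₁` (§4), obeys the space–time Type-I bound with constant `2`, is `α`-RSS in group form, is
backward-singular at the origin, has a spiral scar — and has NEITHER a homogeneous NOR an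
axisymmetric scar (`α ≠ 0`).  So the crux's dichotomy is incomplete already at the kinematic level
at which gen 1 found it satisfiable; only the (open) emptiness of the RSS apex class can save it. -/

section Kinematic

/-- The cut-off `χ(r) = max 0 (min 1 (r − 1))`: `0` for `r ≤ 1`, `1` for `r ≥ 2`, values in `[0,1]`.
[folklore] -/
def spiralCut (r : ℝ) : ℝ := max 0 (min 1 (r - 1))

/-- `χ ≥ 0`. [folklore] -/
theorem spiralCut_nonneg (r : ℝ) : 0 ≤ spiralCut r := le_max_left _ _

/-- `χ ≤ 1`. [folklore] -/
theorem spiralCut_le_one (r : ℝ) : spiralCut r ≤ 1 :=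
  max_le zero_le_one (min_le_left _ _)

/-- `χ(r) = 0` for `r ≤ 1`. [folklore] -/
theorem spiralCut_of_le_one {r : ℝ} (hr : r ≤ 1) : spiralCut r = 0 := by
  unfold spiralCut
  rw [max_eq_left]
  exact (min_le_right _ _).trans (by linarith)

/-- `χ(r) = 1` for `r ≥ 2`. [folklore] -/
theorem spiralCut_of_two_le {r : ℝ} (hr : 2 ≤ r) : spiralCut r = 1 := by
  unfold spiralCut
  rw [min_eq_left (by linarith), max_eq_right zero_le_one]

/-- The horizontal unit vector `e₁ = (1, 0, 0)`. [folklore] -/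
def e1 : ℝ³ := EuclideanSpace.single 0 1

/-- `(e₁)₀ = 1`. [folklore] -/
@[simp] theorem e1_apply_zero : e1 0 = 1 := by simp [e1]
/-- `(e₁)₁ = 0`. [folklore] -/
@[simp] theorem e1_apply_one : e1 1 = 0 := by simp [e1]
/-- `(e₁)₂ = 0`. [folklore] -/
@[simp] theorem e1_apply_two : e1 2 = 0 := by simp [e1]

/-- `‖e₁‖ = 1`. [folklore] -/
theorem norm_e1 : ‖e1‖ = 1 := by simp [e1]

/-- `R_π w = −w` for horizontal `w = R_β e₁`. [folklore] -/
theorem rotZ_pi_rotZ_e1 (β : ℝ) : rotZ Real.pi (rotZ β e1) = -rotZ β e1 := by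
  rw [← rotZ_add, add_comm]
  ext i
  fin_cases i <;> simp [Real.cos_add_pi, Real.sin_add_pi]

/-- **The kinematic spiral field** `u(t,x) = ‖x‖⁻¹ χ(‖x‖/√−t) R(−2α log‖x‖) e₁` for `t < 0`
(`0` for `t ≥ 0`): the final-time shape of a Type-I RSS profile with pattern `A₀ ≡ e₁` (§4).
[cite: PineauVicol2026, §1.2 (arXiv:2607.09619 p. 3)] -/
def spiralField (α : ℝ) : ℝ → ℝ³ → ℝ³ := fun t x =>
  if t < 0 then (‖x‖⁻¹ * spiralCut (‖x‖ / Real.sqrt (-t))) • rotZ (-(2 * α * Real.log ‖x‖)) e1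
  else 0

/-- The field for `t < 0`. [folklore] -/
theorem spiralField_of_neg (α : ℝ) {t : ℝ} (ht : t < 0) (x : ℝ³) :
    spiralField α t x = (‖x‖⁻¹ * spiralCut (‖x‖ / Real.sqrt (-t))) • rotZ (-(2 * α * Real.log ‖x‖)) e1 := by
  simp [spiralField, ht]

/-- `‖u(t,x)‖ = ‖x‖⁻¹ χ(‖x‖/√−t)` for `t < 0`. [folklore] -/
theorem norm_spiralField_of_neg (α : ℝ) {t : ℝ} (ht : t < 0) (x : ℝ³) :
    ‖spiralField α t x‖ = ‖x‖⁻¹ * spiralCut (‖x‖ / Real.sqrt (-t)) := by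
  rw [spiralField_of_neg α ht, norm_smul, norm_rotZ, norm_e1, mul_one,
    Real.norm_of_nonneg (mul_nonneg (inv_nonneg.2 (norm_nonneg _)) (spiralCut_nonneg _))]

/-- Far from the parabola (`‖x‖ ≥ 2√−t`) the cut-off is off: `u(t,x) = ‖x‖⁻¹ R(−2α log‖x‖) e₁`.
[folklore] -/
theorem spiralField_of_two_sqrt_le (α : ℝ) {t : ℝ} (ht : t < 0) {x : ℝ³}
    (hx : 2 * Real.sqrt (-t) ≤ ‖x‖) :
    spiralField α t x = ‖x‖⁻¹ • rotZ (-(2 * α * Real.log ‖x‖)) e1 := by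
  have hs : 0 < Real.sqrt (-t) := Real.sqrt_pos.2 (by linarith)
  rw [spiralField_of_neg α ht, spiralCut_of_two_le ((le_div_iff₀ hs).2 hx), mul_one]

/-- **Type-I space–time bound with constant `2`.** [folklore] -/
theorem hasTypeIDecay_spiralField (α : ℝ) : HasTypeIDecay 2 (spiralField α) := by
  intro t ht x
  have hs : 0 < Real.sqrt (-t) := Real.sqrt_pos.2 (by linarith)
  rw [norm_spiralField_of_neg α ht]
  by_cases hx : ‖x‖ ≤ Real.sqrt (-t)
  · rw [spiralCut_of_le_one ((div_le_one hs).2 hx), mul_zero]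
    positivity
  · push Not at hx
    have hxpos : 0 < ‖x‖ := hs.trans hx
    calc ‖x‖⁻¹ * spiralCut (‖x‖ / Real.sqrt (-t)) ≤ ‖x‖⁻¹ * 1 :=
          mul_le_mul_of_nonneg_left (spiralCut_le_one _) (inv_nonneg.2 (norm_nonneg _))
      _ ≤ 2 / (‖x‖ + Real.sqrt (-t)) := by
          rw [mul_one, inv_eq_one_div, div_le_div_iff₀ hxpos (by positivity)]
          linarith

/-- **The kinematic spiral field is `α`-RSS in group form.** [folklore] -/
theorem isSpiralRSS_spiralField {α : ℝ} (hα : α ≠ 0) : IsSpiralRSS α (spiralField α) := by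
  intro θ t ht x
  set c : ℝ := Real.exp (-θ / (2 * α)) with hc
  have hcpos : 0 < c := Real.exp_pos _
  have hct : c ^ 2 * t < 0 := mul_neg_of_pos_of_neg (by positivity) ht
  have hsqrt : Real.sqrt (-(c ^ 2 * t)) = c * Real.sqrt (-t) := by
    rw [show -(c ^ 2 * t) = c ^ 2 * (-t) by ring, Real.sqrt_mul (sq_nonneg c), Real.sqrt_sq hcpos.le]
  have hlogc : Real.log c = -θ / (2 * α) := by rw [hc, Real.log_exp]
  simp only [conjZ, nsRescale_apply]
  rw [spiralField_of_neg α hct, spiralField_of_neg α ht, norm_rotZ, rotZ_smul', smul_smul,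
    norm_smul, Real.norm_of_nonneg hcpos.le, hsqrt]
  by_cases hx : x = 0
  · subst hx
    simp
  have hxn : 0 < ‖x‖ := norm_pos_iff.2 hx
  have hcs : 0 < c * Real.sqrt (-t) := mul_pos hcpos (Real.sqrt_pos.2 (by linarith))
  congr 1
  · rw [mul_inv, mul_div_mul_left _ _ hcpos.ne']
    field_simp
  · rw [Real.log_mul hcpos.ne' hxn.ne', hlogc, ← rotZ_add]
    congr 1
    field_simp
    ring

/-- **The kinematic spiral field has a spiral scar.** [folklore] -/
theorem spiralScar_spiralField {α : ℝ} (hα : α ≠ 0) : SpiralScar α (spiralField α) :=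
  spiralScar_of_isSpiralRSS hα (isSpiralRSS_spiralField hα)

/-- `essSup f μ = ⊤` as soon as `f` exceeds every finite level on a set of positive measure (copy of
the tree's `essSup_eq_top_of_forall_exists_lt`, `ParasiticSlabFlow.lean`). [folklore] -/
theorem essSup_eq_top_of_forall_exists_lt' {X : Type*} {m : MeasurableSpace X} {μ : Measure X}
    {f : X → ℝ≥0∞} (h : ∀ N : ℝ≥0, ∃ S : Set X, μ S ≠ 0 ∧ ∀ x ∈ S, (N : ℝ≥0∞) < f x) :
    essSup f μ = ⊤ := by
  by_contra hne
  obtain ⟨S, hS, hlt⟩ := h (essSup f μ).toNNReal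
  have hco : ((essSup f μ).toNNReal : ℝ≥0∞) = essSup f μ := ENNReal.coe_toNNReal hne
  have hae := ENNReal.ae_le_essSup f (μ := μ)
  rw [ae_iff] at hae
  refine hS (measure_mono_null (fun x hx => ?_) hae)
  simp only [mem_setOf_eq, not_le]
  rw [← hco]
  exact hlt x hx

/-- **The kinematic spiral field is backward-singular at the origin**: on
`(−(5ρ/16)², 0) × B((3ρ/4)e₁, ρ/8)` the cut-off is off and `‖u‖ = ‖x‖⁻¹ ≥ 8/(7ρ)`. [folklore] -/
theorem isBackwardSingularPoint_spiralField (α : ℝ) : IsBackwardSingularPoint (spiralField α) 0 := by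
  intro r hr
  rw [eLpNorm_exponent_top]
  show essSup (fun z => ‖uncurry (spiralField α) z‖ₑ) _ = ⊤
  apply essSup_eq_top_of_forall_exists_lt'
  intro N
  set ρ : ℝ := min (r / 2) (1 / ((N : ℝ) + 1)) with hρ
  have hρpos : 0 < ρ := lt_min (by positivity) (by positivity)
  have hρr : ρ ≤ r / 2 := min_le_left _ _
  have hρN : ρ ≤ 1 / ((N : ℝ) + 1) := min_le_right _ _
  set x₁ : ℝ³ := (3 * ρ / 4) • e1 with hx₁
  have hnx₁ : ‖x₁‖ = 3 * ρ / 4 := by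
    rw [hx₁, norm_smul, norm_e1, mul_one, Real.norm_of_nonneg (by positivity)]
  set τ : ℝ := (5 * ρ / 16) ^ 2 with hτ
  have hτpos : 0 < τ := by positivity
  refine ⟨Ioo (-τ) 0 ×ˢ ball x₁ (ρ / 8), ?_, ?_⟩
  · have hsub : Ioo (-τ) 0 ×ˢ ball x₁ (ρ / 8) ⊆ parabolicCylinder r (0 : ℝ × ℝ³) := by
      rintro ⟨t, x⟩ ⟨⟨ht1, ht2⟩, hx⟩
      rw [mem_parabolicCylinder]
      refine ⟨⟨?_, by simpa using ht2⟩, ?_⟩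
      · have : τ ≤ r ^ 2 := by
          rw [hτ]; nlinarith
        simp only [Prod.fst_zero]
        linarith
      · simp only [Prod.snd_zero, dist_zero_right]
        have hxx : ‖x - x₁‖ < ρ / 8 := by rwa [← dist_eq_norm]
        calc ‖x‖ = ‖(x - x₁) + x₁‖ := by rw [sub_add_cancel]
          _ ≤ ‖x - x₁‖ + ‖x₁‖ := norm_add_le _ _
          _ < r := by rw [hnx₁]; linarith
    rw [Measure.restrict_apply (measurableSet_Ioo.prod measurableSet_ball),
      inter_eq_left.2 hsub, Measure.volume_eq_prod, Measure.prod_prod]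
    refine mul_ne_zero ?_ (measure_ball_pos volume x₁ (by positivity)).ne'
    rw [Real.volume_Ioo]
    simp [hτpos]
  · rintro ⟨t, x⟩ ⟨⟨ht1, ht2⟩, hx⟩
    simp only [uncurry_apply_pair]
    have hxx : ‖x - x₁‖ < ρ / 8 := by rwa [mem_ball, dist_eq_norm] at hx
    have hxlow : 5 * ρ / 8 ≤ ‖x‖ := by
      have : ‖x₁‖ ≤ ‖x‖ + ‖x - x₁‖ := by
        calc ‖x₁‖ = ‖x - (x - x₁)‖ := by rw [sub_sub_cancel]
          _ ≤ ‖x‖ + ‖x - x₁‖ := norm_sub_le _ _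
      rw [hnx₁] at this
      linarith
    have hxup : ‖x‖ ≤ 7 * ρ / 8 := by
      calc ‖x‖ = ‖(x - x₁) + x₁‖ := by rw [sub_add_cancel]
        _ ≤ ‖x - x₁‖ + ‖x₁‖ := norm_add_le _ _
        _ ≤ 7 * ρ / 8 := by rw [hnx₁]; linarith
    have hxpos : 0 < ‖x‖ := lt_of_lt_of_le (by positivity) hxlow
    have hst : Real.sqrt (-t) < 5 * ρ / 16 := by
      rw [Real.sqrt_lt' (by positivity)]
      rw [hτ] at ht1
      linarith
    have h2 : 2 * Real.sqrt (-t) ≤ ‖x‖ := by linarith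
    rw [spiralField_of_two_sqrt_le α ht2 h2, enorm_smul, ← ofReal_norm, ← ofReal_norm, norm_rotZ,
      norm_e1, ENNReal.ofReal_one, mul_one, Real.norm_of_nonneg (inv_nonneg.2 (norm_nonneg _)),
      show ((N : ℝ≥0) : ℝ≥0∞) = ENNReal.ofReal (N : ℝ) by simp,
      ENNReal.ofReal_lt_ofReal_iff (inv_pos.2 hxpos)]
    have hxlt : ‖x‖ < 1 / ((N : ℝ) + 1) := by
      calc ‖x‖ ≤ 7 * ρ / 8 := hxup
        _ < ρ := by linarith
        _ ≤ 1 / ((N : ℝ) + 1) := hρN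
    calc (N : ℝ) < (N : ℝ) + 1 := by linarith
      _ ≤ ‖x‖⁻¹ := by
          rw [le_inv_comm₀ (by positivity) hxpos, inv_eq_one_div]
          exact hxlt.le


/-- On the region where the cut-off is off, rotating by `π` flips the field:
`(conjZ π u − u)(t, x) = −(2‖x‖⁻¹) • R(−2α log‖x‖) e₁`. [folklore] -/
theorem conjZ_pi_sub_spiralField (α : ℝ) {t : ℝ} (ht : t < 0) {x : ℝ³}
    (hx : 2 * Real.sqrt (-t) ≤ ‖x‖) :
    conjZ Real.pi (spiralField α) t x - spiralField α t x =
      -((2 * ‖x‖⁻¹) • rotZ (-(2 * α * Real.log ‖x‖)) e1) := by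
  have hx' : 2 * Real.sqrt (-t) ≤ ‖rotZ (-Real.pi) x‖ := by rwa [norm_rotZ]
  simp only [conjZ]
  rw [spiralField_of_two_sqrt_le α ht hx', spiralField_of_two_sqrt_le α ht hx, norm_rotZ, rotZ_smul',
    rotZ_pi_rotZ_e1, smul_neg, mul_smul, two_smul]
  abel

/-- Its norm there is `2/‖x‖`. [folklore] -/
theorem norm_conjZ_pi_sub_spiralField (α : ℝ) {t : ℝ} (ht : t < 0) {x : ℝ³}
    (hx : 2 * Real.sqrt (-t) ≤ ‖x‖) :
    ‖conjZ Real.pi (spiralField α) t x - spiralField α t x‖ = 2 * ‖x‖⁻¹ := by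
  rw [conjZ_pi_sub_spiralField α ht hx, norm_neg, norm_smul, norm_rotZ, norm_e1, mul_one,
    Real.norm_of_nonneg (by positivity)]

/-- **The kinematic spiral field has NO axisymmetric scar**: for `θ = π` and `K = B̄(2e₁, 1/2)`
the scar difference is `2/‖x‖ ≥ 8/9` on `(−δ, 0) × B(2e₁, 1/4)` for every `δ < 1/2`, so it does
not tend to `0`. [folklore] -/
theorem not_axiScar_spiralField (α : ℝ) : ¬ AxiScar (spiralField α) := by
  intro hA
  set x₀ : ℝ³ := (2 : ℝ) • e1 with hx₀
  have hnx₀ : ‖x₀‖ = 2 := by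
    rw [hx₀, norm_smul, norm_e1, mul_one, Real.norm_of_nonneg (by norm_num)]
  have hK : IsCompact (closedBall x₀ (1 / 2)) := isCompact_closedBall _ _
  have h0 : (0 : ℝ³) ∉ closedBall x₀ (1 / 2) := by
    rw [mem_closedBall, dist_comm, dist_zero_right, hnx₀]
    norm_num
  have hT := hA Real.pi (closedBall x₀ (1 / 2)) hK h0
  set c : ℝ≥0∞ := ENNReal.ofReal (8 / 9) with hc
  have hcpos : (0 : ℝ≥0∞) < c := by rw [hc]; exact ENNReal.ofReal_pos.2 (by norm_num)
  have hev : ∀ᶠ δ in 𝓝[>] (0 : ℝ), eLpNorm (uncurry (conjZ Real.pi (spiralField α)) -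
      uncurry (spiralField α)) ⊤ (volume.restrict (Ioo (-δ) 0 ×ˢ closedBall x₀ (1 / 2))) < c :=
    hT (Iio_mem_nhds hcpos)
  have hev2 : ∀ᶠ δ in 𝓝[>] (0 : ℝ), δ ∈ Ioo (0 : ℝ) (1 / 2) := Ioo_mem_nhdsGT (by norm_num)
  obtain ⟨δ, hlt, hδ0, hδ⟩ := (hev.and hev2).exists
  -- the lower bound `c ≤ ess sup` on `(−δ, 0) × B(x₀, 1/4)`
  refine absurd hlt (not_lt.2 ?_)
  rw [eLpNorm_exponent_top]
  by_contra hlt'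
  push Not at hlt'
  have hae := ae_lt_of_essSup_lt hlt'
  rw [ae_iff] at hae
  set S : Set (ℝ × ℝ³) := Ioo (-δ) 0 ×ˢ ball x₀ (1 / 4) with hS
  have hSsub : S ⊆ Ioo (-δ) 0 ×ˢ closedBall x₀ (1 / 2) :=
    prod_mono Subset.rfl (ball_subset_closedBall.trans (closedBall_subset_closedBall (by norm_num)))
  have hSpos : (volume.restrict (Ioo (-δ) (0 : ℝ) ×ˢ closedBall x₀ (1 / 2))) S ≠ 0 := by
    rw [Measure.restrict_apply (measurableSet_Ioo.prod measurableSet_ball), inter_eq_left.2 hSsub,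
      hS, Measure.volume_eq_prod, Measure.prod_prod]
    refine mul_ne_zero ?_ (measure_ball_pos volume x₀ (by norm_num)).ne'
    rw [Real.volume_Ioo]
    simp [hδ0]
  refine hSpos (measure_mono_null (fun z hz => ?_) hae)
  obtain ⟨⟨ht1, ht2⟩, hx⟩ := hz
  simp only [mem_setOf_eq, not_lt]
  -- on `S`: `‖x‖ ∈ [7/4, 9/4]` and `2√−t < 7/4`
  have hxx : ‖z.2 - x₀‖ < 1 / 4 := by rwa [mem_ball, dist_eq_norm] at hx
  have hxlow : 7 / 4 ≤ ‖z.2‖ := by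
    have : ‖x₀‖ ≤ ‖z.2‖ + ‖z.2 - x₀‖ := by
      calc ‖x₀‖ = ‖z.2 - (z.2 - x₀)‖ := by rw [sub_sub_cancel]
        _ ≤ ‖z.2‖ + ‖z.2 - x₀‖ := norm_sub_le _ _
    rw [hnx₀] at this
    linarith
  have hxup : ‖z.2‖ ≤ 9 / 4 := by
    calc ‖z.2‖ = ‖(z.2 - x₀) + x₀‖ := by rw [sub_add_cancel]
      _ ≤ ‖z.2 - x₀‖ + ‖x₀‖ := norm_add_le _ _
      _ ≤ 9 / 4 := by rw [hnx₀]; linarith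
  have hxpos : 0 < ‖z.2‖ := lt_of_lt_of_le (by norm_num) hxlow
  have ht : z.1 < 0 := ht2
  have hst : Real.sqrt (-z.1) < 7 / 8 := by
    rw [Real.sqrt_lt' (by norm_num)]
    linarith
  have h2 : 2 * Real.sqrt (-z.1) ≤ ‖z.2‖ := by linarith
  show c ≤ ‖conjZ Real.pi (spiralField α) z.1 z.2 - spiralField α z.1 z.2‖ₑ
  rw [← ofReal_norm, norm_conjZ_pi_sub_spiralField α ht h2, hc]
  refine ENNReal.ofReal_le_ofReal ?_
  rw [mul_comm, ← div_eq_inv_mul, le_div_iff₀ hxpos]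
  linarith

/-- … hence NO homogeneous scar either (`homScar_iff_axiScar_of_isSpiralRSS`). [folklore] -/
theorem not_homScar_spiralField {α : ℝ} (hα : α ≠ 0) : ¬ HomScar (spiralField α) := fun h =>
  not_axiScar_spiralField α ((homScar_iff_axiScar_of_isSpiralRSS hα (isSpiralRSS_spiralField hα)).1 h)

/-- **Summary of §5 — the crux's dichotomy is incomplete at the kinematic level.**  For every
`α ≠ 0` there is an explicit field in the Type-I envelope class (space–time bound, backward-singular
origin) which is `α`-RSS, has a spiral scar, and has NEITHER a homogeneous NOR an axisymmetric scar.
Contrast gen 1 (the envelope `C e₃/(‖x‖+√−t)` has both): the only thing standing between this shape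
and a refutation of the crux is the Navier–Stokes system, i.e. the (open) emptiness of the Type-I
RSS class with non-equivariant pattern (Pineau–Vicol 2026 Conj. 1.1).
[cite: PineauVicol2026, Conjecture 1.1 (arXiv:2607.09619 p. 3)] -/
theorem exists_kinematic_spiral_counterexample {α : ℝ} (hα : α ≠ 0) :
    ∃ u : ℝ → ℝ³ → ℝ³, HasTypeIDecay 2 u ∧ IsBackwardSingularPoint u 0 ∧ IsSpiralRSS α u ∧
      SpiralScar α u ∧ ¬ HomScar u ∧ ¬ AxiScar u :=
  ⟨spiralField α, hasTypeIDecay_spiralField α, isBackwardSingularPoint_spiralField α,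
    isSpiralRSS_spiralField hα, spiralScar_spiralField hα, not_homScar_spiralField hα,
    not_axiScar_spiralField α⟩

end Kinematic


/-! ## §6 Load-bearing hypothesis: the singularity of the ANTECEDENT profile

Dropping `IsBackwardSingularPoint u 0` from the antecedent only (keeping it in the conclusion) turns
the crux into the bare existence statement "a singular apex profile with a homogeneous or
axisymmetric scar exists" (the zero flow inhabits the weakened antecedent at `C = 0`), which implies
the open A–B bullet `LocalTypeISingularityExists`; so in the (L)-world the weakened crux is FALSE:
any proof of the crux must use the antecedent's singularity (it cannot be a construction). -/

section LoadBearing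

/-- The crux with the singularity hypothesis dropped from the ANTECEDENT only. -/
def SymmetricScarExistsWithoutSingularAntecedent : Prop :=
  ∀ C : ℝ, (∃ (u : ℝ → ℝ³ → ℝ³) (p : ℝ → ℝ³ → ℝ) (G : ℝ → ℝ³ → ℝ³ →L[ℝ] ℝ³),
      IsSuitableWeakSolutionOn 𝕊 1 0 u p ∧ HasWeakSpatialGradientOn 𝕊 u G ∧
      typeIBound (Iio (0 : ℝ) ×ˢ univ) u p G < ⊤ ∧ HasTypeIDecay C u) →
    ∃ (C' : ℝ) (u : ℝ → ℝ³ → ℝ³) (p : ℝ → ℝ³ → ℝ) (G : ℝ → ℝ³ → ℝ³ →L[ℝ] ℝ³),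
      IsSuitableWeakSolutionOn 𝕊 1 0 u p ∧ HasWeakSpatialGradientOn 𝕊 u G ∧
      typeIBound (Iio (0 : ℝ) ×ˢ univ) u p G < ⊤ ∧ HasTypeIDecay C' u ∧
      IsBackwardSingularPoint u 0 ∧ (HomScar u ∨ AxiScar u)

/-- The zero flow inhabits the weakened antecedent at `C = 0` (tree `isSuitableWeakSolutionOn_zero`,
`hasWeakSpatialGradientOn_zero`, `typeIBound_zero`). [folklore] -/
theorem zero_mem_apexClass :
    IsSuitableWeakSolutionOn 𝕊 1 0 (0 : ℝ → ℝ³ → ℝ³) (0 : ℝ → ℝ³ → ℝ) ∧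
      HasWeakSpatialGradientOn 𝕊 (0 : ℝ → ℝ³ → ℝ³) (0 : ℝ → ℝ³ → ℝ³ →L[ℝ] ℝ³) ∧
      typeIBound (Iio (0 : ℝ) ×ˢ univ) (0 : ℝ → ℝ³ → ℝ³) 0 0 < ⊤ ∧
      HasTypeIDecay 0 (0 : ℝ → ℝ³ → ℝ³) := by
  refine ⟨isSuitableWeakSolutionOn_zero _ 1, hasWeakSpatialGradientOn_zero _, ?_, fun t _ x => ?_⟩
  · rw [typeIBound_zero]
    exact ENNReal.zero_lt_top
  · simp

/-- **Without the antecedent's singularity the crux asserts a Type-I singularity**: the weakened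
crux implies `LocalTypeISingularityExists` (its consequent, fed by the zero flow, is a singular
apex profile, packaged by `localTypeISingularityExists_of_slabProfile`). [cite: AlbrittonBarker2019, Thm 1.1] -/
theorem localTypeISingularityExists_of_withoutSingularAntecedent
    (h : SymmetricScarExistsWithoutSingularAntecedent) : LocalTypeISingularityExists := by
  obtain ⟨hsw, hwg, hI, hdec⟩ := zero_mem_apexClass
  obtain ⟨-, u, p, G, hsw', hwg', hI', -, hsing', -⟩ := h 0 ⟨0, 0, 0, hsw, hwg, hI, hdec⟩
  exact localTypeISingularityExists_of_slabProfile hsw' hwg' hI' hsing'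

/-- **`_false_without_` the antecedent's singularity, in the (L)-world**: if no suitable weak
solution has a local Type I singular point, the weakened crux is false — whereas the crux itself is
then true (`symmetricScarExists_of_not_localTypeISingularityExists`).  So the singularity hypothesis
of the antecedent is load-bearing: it is what makes the crux a SELECTION statement rather than a
construction. [cite: AlbrittonBarker2019, Thm 1.1] -/
theorem symmetricScarExists_false_without_singularAntecedent (hno : ¬ LocalTypeISingularityExists) :
    ¬ SymmetricScarExistsWithoutSingularAntecedent := fun h =>
  hno (localTypeISingularityExists_of_withoutSingularAntecedent h)

/-- Under `¬ LocalTypeISingularityExists` the crux and its weakening have OPPOSITE truth values.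
[cite: AlbrittonBarker2019, Thm 1.1] -/
theorem crux_and_not_weakened_of_not_localTypeISingularityExists (hno : ¬ LocalTypeISingularityExists) :
    SymmetricScarExists ∧ ¬ SymmetricScarExistsWithoutSingularAntecedent :=
  ⟨symmetricScarExists_of_not_localTypeISingularityExists hno,
    symmetricScarExists_false_without_singularAntecedent hno⟩

end LoadBearing


/-! ## §7 (gen 3) Which conjuncts of the CONCLUSION are load-bearing

LANDING as `Theorems/SymmetricScarExists/Negative/ConclusionLoadBearing.lean` (p71687).  §6 dissected
the antecedent; here the conclusion `∃ C' u p G, SWS ∧ WG ∧ 𝐈 < ⊤ ∧ Decay C' ∧ Singular ∧ (Hom ∨ Axi)`: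

* drop `Singular` ⇒ the statement is TRUE outright (zero flow: `homScar_zero'`, `axiScar_zero'`);
* drop ONLY the Navier–Stokes membership `SWS` ⇒ TRUE outright: the sibling disprover's kinematic
  PARABOLIC BUMP `χ(|x|²/(−t))/√(−t) e₁` (`Literature.Analysis.FluidPDE.ParabolicBump.apexVelocity`:
  weak gradient, `𝐈(ℝ³×ℝ₋) < ⊤` with pressure `0`, decay constant `3`, backward-singular origin) has a
  support shrinking into the origin, hence the ZERO scar, hence BOTH scar symmetries
  (`EventuallyInsideBalls'`, `sameScar_of_eventuallyInsideBalls'`, stable under rescaling and rotation);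
  it is moreover exactly self-similar;
* the sibling support `NoMildScar` (stmt-11723) is likewise FALSE without its Navier–Stokes hypothesis
  (same bump, `σ = 0 ∈ L³`): its content is the dynamics (ESS), not the function class;
* by contrast the conclusion's DECAY is not load-bearing relative to (L): dropped, the statement still
  asserts a local Type-I singularity when instantiated, so under `¬ LocalTypeISingularityExists` it is
  equivalent to the crux.

So the conclusion is non-trivial exactly through "Navier–Stokes ∧ singular" — the same perimeter as
the antecedent (§1–§2). -/

section ConclusionLoadBearing

variable {f g : ℝ → ℝ³ → ℝ³}

/-- The support of `f(t,·)` shrinks into the origin as `t ↑ 0` (twin of the landed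
`Negative.EventuallyInsideBalls`). [folklore] -/
def EventuallyInsideBalls' (f : ℝ → ℝ³ → ℝ³) : Prop :=
  ∀ ρ : ℝ, 0 < ρ → ∃ δ₀ : ℝ, 0 < δ₀ ∧ ∀ t ∈ Ioo (-δ₀) 0, ∀ x : ℝ³, ρ ≤ ‖x‖ → f t x = 0

/-- A compact set avoiding the origin keeps a positive distance from it. [folklore] -/
theorem exists_pos_le_norm_of_isCompact' {K : Set ℝ³} (hK : IsCompact K) (h0 : (0 : ℝ³) ∉ K) :
    ∃ ρ : ℝ, 0 < ρ ∧ ∀ x ∈ K, ρ ≤ ‖x‖ := by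
  obtain ⟨ρ, hρ, hball⟩ := Metric.isOpen_iff.1 hK.isClosed.isOpen_compl 0 (mem_compl h0)
  refine ⟨ρ, hρ, fun x hx => ?_⟩
  by_contra hlt
  push Not at hlt
  exact hball (by simpa using hlt) hx

/-- **Two fields whose supports shrink into the origin have the same (zero) scar.** [folklore] -/
theorem sameScar_of_eventuallyInsideBalls' (hf : EventuallyInsideBalls' f) (hg : EventuallyInsideBalls' g) :
    SameScar f g := by
  intro K hK h0
  obtain ⟨ρ, hρ, hKρ⟩ := exists_pos_le_norm_of_isCompact' hK h0
  obtain ⟨δf, hδf, hf0⟩ := hf ρ hρ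
  obtain ⟨δg, hδg, hg0⟩ := hg ρ hρ
  have hδ : 0 < min δf δg := lt_min hδf hδg
  have hzero : ∀ δ ∈ Ioo (0 : ℝ) (min δf δg),
      eLpNorm (uncurry f - uncurry g) ⊤ (volume.restrict (Ioo (-δ) 0 ×ˢ K)) = 0 := by
    intro δ hδ'
    have hae : (uncurry f - uncurry g) =ᵐ[volume.restrict (Ioo (-δ) 0 ×ˢ K)] 0 := by
      filter_upwards [ae_restrict_mem (measurableSet_Ioo.prod hK.measurableSet)] with z hz
      obtain ⟨⟨hz1, hz2⟩, hzK⟩ := hz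
      have htf : z.1 ∈ Ioo (-δf) 0 := ⟨by linarith [hδ'.2, min_le_left δf δg], hz2⟩
      have htg : z.1 ∈ Ioo (-δg) 0 := ⟨by linarith [hδ'.2, min_le_right δf δg], hz2⟩
      simp only [Pi.sub_apply, uncurry, Pi.zero_apply]
      rw [hf0 z.1 htf z.2 (hKρ z.2 hzK), hg0 z.1 htg z.2 (hKρ z.2 hzK), sub_zero]
    rw [eLpNorm_congr_ae hae, eLpNorm_zero]
  refine Tendsto.congr' ?_ tendsto_const_nhds
  filter_upwards [Ioo_mem_nhdsGT hδ] with δ hδ'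
  exact (hzero δ hδ').symm

/-- Stability under the Navier–Stokes rescaling. [folklore] -/
theorem EventuallyInsideBalls'.rescale (hf : EventuallyInsideBalls' f) {lam : ℝ} (hlam : 0 < lam) :
    EventuallyInsideBalls' (nsRescale lam f) := by
  intro ρ hρ
  obtain ⟨δ₀, hδ₀, h0⟩ := hf (lam * ρ) (by positivity)
  refine ⟨δ₀ / lam ^ 2, by positivity, fun t ht x hx => ?_⟩
  rw [nsRescale_apply]
  have hl2 : (0 : ℝ) < lam ^ 2 := by positivity
  have ht' : lam ^ 2 * t ∈ Ioo (-δ₀) 0 := by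
    obtain ⟨ht1, ht2⟩ := ht
    constructor
    · have := mul_lt_mul_of_pos_left ht1 hl2
      rwa [show lam ^ 2 * (-(δ₀ / lam ^ 2)) = -δ₀ by field_simp] at this
    · exact mul_neg_of_pos_of_neg hl2 ht2
  have hx' : lam * ρ ≤ ‖lam • x‖ := by
    rw [norm_smul, Real.norm_of_nonneg hlam.le]
    exact mul_le_mul_of_nonneg_left hx hlam.le
  rw [h0 _ ht' _ hx', smul_zero]

/-- Stability under rotation-conjugation. [folklore] -/
theorem EventuallyInsideBalls'.rotate (hf : EventuallyInsideBalls' f) (θ : ℝ) :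
    EventuallyInsideBalls' (conjZ θ f) := by
  intro ρ hρ
  obtain ⟨δ₀, hδ₀, h0⟩ := hf ρ hρ
  refine ⟨δ₀, hδ₀, fun t ht x hx => ?_⟩
  simp only [conjZ]
  rw [h0 t ht (rotZ (-θ) x) (by rwa [norm_rotZ]), rotZ_zero_vec']

/-- Such a field has a homogeneous AND an axisymmetric scar. [folklore] -/
theorem homScar_and_axiScar_of_eventuallyInsideBalls' (hf : EventuallyInsideBalls' f) :
    HomScar f ∧ AxiScar f :=
  ⟨fun _ hlam => sameScar_of_eventuallyInsideBalls' (hf.rescale hlam) hf,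
    fun θ => sameScar_of_eventuallyInsideBalls' (hf.rotate θ) hf⟩

/-- The zero flow has both scar symmetries. [folklore] -/
theorem homScar_and_axiScar_zero : HomScar (0 : ℝ → ℝ³ → ℝ³) ∧ AxiScar (0 : ℝ → ℝ³ → ℝ³) :=
  homScar_and_axiScar_of_eventuallyInsideBalls' fun _ _ => ⟨1, one_pos, fun _ _ _ _ => rfl⟩

/-- **The bump's support shrinks into the origin** (`u(t,x) = 0` for `‖x‖ ≥ ρ`, `−ρ²/2 < t < 0`).
[folklore] -/
theorem eventuallyInsideBalls'_apexVelocity : EventuallyInsideBalls' ParabolicBump.apexVelocity := by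
  intro ρ hρ
  refine ⟨ρ ^ 2 / 2, by positivity, fun t ht x hx => ?_⟩
  obtain ⟨ht1, ht2⟩ := ht
  have hsq : ρ ^ 2 ≤ ‖x‖ ^ 2 := pow_le_pow_left₀ hρ.le hx 2
  show ParabolicBump.apexAmp t x • parasiticDir = 0
  rw [ParabolicBump.apexAmp_eq_zero_of ht2 (by linarith), zero_smul]

/-- **The bump is exactly self-similar** on `t < 0`. [folklore] -/
theorem nsRescale_apexVelocity_of_neg' {lam : ℝ} (hlam : 0 < lam) {t : ℝ} (ht : t < 0) (x : ℝ³) :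
    nsRescale lam ParabolicBump.apexVelocity t x = ParabolicBump.apexVelocity t x := by
  rw [nsRescale_apply]
  show lam • (ParabolicBump.apexAmp (lam ^ 2 * t) (lam • x) • parasiticDir) =
    ParabolicBump.apexAmp t x • parasiticDir
  rw [smul_smul]
  congr 1
  simp only [ParabolicBump.apexAmp]
  have hl2 : (0 : ℝ) < lam ^ 2 := by positivity
  have hsq : Real.sqrt (-(lam ^ 2 * t)) = lam * Real.sqrt (-t) := by
    rw [show -(lam ^ 2 * t) = lam ^ 2 * (-t) by ring, Real.sqrt_mul (sq_nonneg lam) (-t),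
      Real.sqrt_sq hlam.le]
  have harg : ‖lam • x‖ ^ 2 / -(lam ^ 2 * t) = ‖x‖ ^ 2 / -t := by
    rw [norm_smul, Real.norm_of_nonneg hlam.le, mul_pow,
      show -(lam ^ 2 * t) = lam ^ 2 * (-t) by ring, mul_div_mul_left _ _ hl2.ne']
  rw [harg, hsq]
  have hs : 0 < Real.sqrt (-t) := Real.sqrt_pos.2 (by linarith)
  field_simp

/-- **`S` without the Navier–Stokes equations in the CONCLUSION is true outright**: the bump
witnesses every conjunct but `IsSuitableWeakSolutionOn`, with both scar symmetries.
[cite: AlbrittonBarker2019, §1; KNSS2009, (1.6)] -/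
theorem symScarWitness_without_navierStokes :
    ∃ (C' : ℝ) (u : ℝ → ℝ³ → ℝ³) (p : ℝ → ℝ³ → ℝ) (G : ℝ → ℝ³ → ℝ³ →L[ℝ] ℝ³),
      HasWeakSpatialGradientOn 𝕊 u G ∧ typeIBound (Iio (0 : ℝ) ×ˢ univ) u p G < ⊤ ∧ HasTypeIDecay C' u ∧
      IsBackwardSingularPoint u 0 ∧ (HomScar u ∧ AxiScar u) :=
  ⟨3, ParabolicBump.apexVelocity, 0, ParabolicBump.apexGradient,
    ParabolicBump.apex_hasWeakSpatialGradientOn, ParabolicBump.typeIBound_apex_lt_top,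
    ParabolicBump.apex_hasTypeIDecay, ParabolicBump.apex_isBackwardSingularPoint,
    homScar_and_axiScar_of_eventuallyInsideBalls' eventuallyInsideBalls'_apexVelocity⟩

/-- **`S` without the conclusion's singularity is true outright**: the zero flow (suitable weak,
`𝐈 = 0`, decay `0`, `zero_mem_apexClass`) witnesses it with both scar symmetries. [folklore] -/
theorem symScarWitness_without_singular :
    ∃ (C' : ℝ) (u : ℝ → ℝ³ → ℝ³) (p : ℝ → ℝ³ → ℝ) (G : ℝ → ℝ³ → ℝ³ →L[ℝ] ℝ³),
      IsSuitableWeakSolutionOn 𝕊 1 0 u p ∧ HasWeakSpatialGradientOn 𝕊 u G ∧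
      typeIBound (Iio (0 : ℝ) ×ˢ univ) u p G < ⊤ ∧ HasTypeIDecay C' u ∧ (HomScar u ∧ AxiScar u) := by
  obtain ⟨hsw, hwg, hI, hdec⟩ := zero_mem_apexClass
  exact ⟨0, 0, 0, 0, hsw, hwg, hI, hdec, homScar_and_axiScar_zero⟩

/-- **The sibling support `NoMildScar` is false without the equations**: the bump has the mild scar
`σ = 0`. [cite: EscauriazaSereginSverak2003, Thm 1] -/
theorem noMildScar_witness_without_navierStokes :
    ∃ (u : ℝ → ℝ³ → ℝ³) (G : ℝ → ℝ³ → ℝ³ →L[ℝ] ℝ³),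
      HasWeakSpatialGradientOn 𝕊 u G ∧ typeIBound (Iio (0 : ℝ) ×ˢ univ) u 0 G < ⊤ ∧ HasTypeIDecay 3 u ∧
      IsBackwardSingularPoint u 0 ∧ SameScar u 0 :=
  ⟨ParabolicBump.apexVelocity, ParabolicBump.apexGradient, ParabolicBump.apex_hasWeakSpatialGradientOn,
    ParabolicBump.typeIBound_apex_lt_top, ParabolicBump.apex_hasTypeIDecay,
    ParabolicBump.apex_isBackwardSingularPoint,
    sameScar_of_eventuallyInsideBalls' eventuallyInsideBalls'_apexVelocity
      fun _ _ => ⟨1, one_pos, fun _ _ _ _ => rfl⟩⟩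

end ConclusionLoadBearing

/-! ## §8 (gen 3) The costume: inside the route's belief system the crux IS the target

LANDING as `Theorems/SymmetricScarExists/Negative/TargetCostume.lean` (p71696; gen 1 had it in evidence):
granting the route's own `ScarRigidity` and the three supports, the crux's conclusion is never
instantiated, so `S ↔ X`; in any world with a singular apex profile `S` and `ScarRigidity` exclude each
other.  Every line for `S` that does not refute `ScarRigidity` is a line for `X`. -/

section Costume

/-- Under `ScarRigidity` + the three supports no singular apex profile has a homogeneous or an
axisymmetric scar. [cite: Tsai1998, Thm 2; SereginSverak2009, Thm 3.1] -/
theorem not_symScarWitness_of_scarRigidity' (hSR : ScarRigidity) (hCov : SimilarityCovariance)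
    (hSS : SelfSimilarApexFatal) (hAx : AxisymmetricApexFatal) :
    ¬ ∃ (C' : ℝ) (u : ℝ → ℝ³ → ℝ³) (p : ℝ → ℝ³ → ℝ) (G : ℝ → ℝ³ → ℝ³ →L[ℝ] ℝ³),
      IsSuitableWeakSolutionOn 𝕊 1 0 u p ∧ HasWeakSpatialGradientOn 𝕊 u G ∧
      typeIBound (Iio (0 : ℝ) ×ˢ univ) u p G < ⊤ ∧ HasTypeIDecay C' u ∧
      IsBackwardSingularPoint u 0 ∧ (HomScar u ∨ AxiScar u) := by
  rintro ⟨C', z, pz, Gz, hsz, hgz, hIz, hdz, hsingz, hsym⟩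
  rcases hsym with hhom | hax
  · refine hSS z pz Gz C' hsz hgz hIz hdz hsingz fun lam hlam => ?_
    obtain ⟨q₁, H₁, hs₁, hg₁, hI₁, hd₁, hsing₁⟩ := (hCov z pz Gz C' hsz hgz hIz hdz hsingz).1 lam hlam
    exact hSR _ q₁ H₁ z pz Gz C' hs₁ hg₁ hI₁ hd₁ hsz hgz hIz hdz hsing₁ hsingz (hhom lam hlam)
  · refine hAx z pz Gz C' hsz hgz hIz hdz hsingz fun θ => ?_
    obtain ⟨q₁, H₁, hs₁, hg₁, hI₁, hd₁, hsing₁⟩ := (hCov z pz Gz C' hsz hgz hIz hdz hsingz).2 θ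
    exact hSR _ q₁ H₁ z pz Gz C' hs₁ hg₁ hI₁ hd₁ hsz hgz hIz hdz hsing₁ hsingz (hax θ)

/-- **`S ↔ X` given the route's other items.** [cite: Tsai1998, Thm 2; SereginSverak2009, Thm 3.1] -/
theorem symmetricScarExists_iff_noApexTypeIProfile' (hSR : ScarRigidity) (hCov : SimilarityCovariance)
    (hSS : SelfSimilarApexFatal) (hAx : AxisymmetricApexFatal) :
    SymmetricScarExists ↔ NoApexTypeIProfile := by
  refine ⟨fun hZ u p G C hsw hwg hI hdec hsing => ?_, fun hX C hex => ?_⟩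
  · exact not_symScarWitness_of_scarRigidity' hSR hCov hSS hAx (hZ C ⟨u, p, G, hsw, hwg, hI, hdec, hsing⟩)
  · obtain ⟨u, p, G, hsw, hwg, hI, hdec, hsing⟩ := hex
    exact absurd hsing (hX u p G C hsw hwg hI hdec)

/-- **In any world with a singular apex profile, `S` and `ScarRigidity` exclude each other.**
[cite: Tsai1998, Thm 2; SereginSverak2009, Thm 3.1] -/
theorem not_symmetricScarExists_and_scarRigidity (hCov : SimilarityCovariance)
    (hSS : SelfSimilarApexFatal) (hAx : AxisymmetricApexFatal)
    (hex : ∃ (C : ℝ) (u : ℝ → ℝ³ → ℝ³) (p : ℝ → ℝ³ → ℝ) (G : ℝ → ℝ³ → ℝ³ →L[ℝ] ℝ³),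
      IsSuitableWeakSolutionOn 𝕊 1 0 u p ∧ HasWeakSpatialGradientOn 𝕊 u G ∧
      typeIBound (Iio (0 : ℝ) ×ˢ univ) u p G < ⊤ ∧ HasTypeIDecay C u ∧ IsBackwardSingularPoint u 0) :
    ¬ (SymmetricScarExists ∧ ScarRigidity) := by
  rintro ⟨hZ, hSR⟩
  obtain ⟨C, u, p, G, hsw, hwg, hI, hdec, hsing⟩ := hex
  exact (symmetricScarExists_iff_noApexTypeIProfile' hSR hCov hSS hAx).1 hZ u p G C hsw hwg hI hdec hsing

end Costume

/-! ## §9 (gen 3) The abstract selection skeleton is false; RSS scar orbits realise the counterexample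

LANDING as `Theorems/SymmetricScarExists/Negative/SelectionSkeleton.lean` (p71705).  The route's
foreseen split `ScarMapContinuous → OneSliceSelection → S` rests, once the fluid mechanics is stripped,
on: "a non-empty compact Hausdorff space with a continuous `ℝ`-flow `φ` (zoom) and a commuting circle
action `ρ` (rotations about `e₃`) has a `φ`-fixed or a `ρ`-fixed point".  FALSE: translations on `ℝ/ℤ`
(`not_oneSliceSelectionSkeleton'`).  In the crux's own terms this is the scar orbit of an `α`-RSS field
(§4–§5): the zoom flow on it is PERIODIC (`sameScar_nsRescale_mul_period_of_isSpiralRSS`: rescaling by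
`λ e^{π/α}` has the same scar as rescaling by `λ`) and each rotation acts as a rescaling — a circle on
which both symmetries translate.  So compactness + scar-map continuity + commuting symmetries select
nothing; an engine needs a minimality-breaking input (a monotone quantity — none known, A–B §1 — or the
Type-I (R)DSS Liouville wall of §4). -/

section Skeleton

/-- The abstract one-slice selection principle (twin of the landed `Negative.OneSliceSelectionSkeleton`). -/
def OneSliceSelectionSkeleton' : Prop :=
  ∀ (X : Type) [TopologicalSpace X] [CompactSpace X] [T2Space X] [Nonempty X]
    (φ ρ : ℝ → X → X),
    Continuous (uncurry φ) → Continuous (uncurry ρ) →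
    (∀ x, φ 0 x = x) → (∀ s t x, φ (s + t) x = φ s (φ t x)) →
    (∀ x, ρ 0 x = x) → (∀ s t x, ρ (s + t) x = ρ s (ρ t x)) → (∀ x, ρ 1 x = x) →
    (∀ s θ x, φ s (ρ θ x) = ρ θ (φ s x)) →
    ∃ x, (∀ s, φ s x = x) ∨ (∀ θ, ρ θ x = x)

/-- `(1/2 : ℝ) ≠ 0` in `ℝ/ℤ`. [folklore] -/
theorem addCircle_one_half_ne_zero' : ((1 / 2 : ℝ) : AddCircle (1 : ℝ)) ≠ 0 := by
  intro h
  rw [AddCircle.coe_eq_zero_iff] at h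
  obtain ⟨n, hn⟩ := h
  rw [zsmul_eq_mul, mul_one] at hn
  have h2 : (2 * n : ℤ) = 1 := by
    have : (2 * n : ℝ) = 1 := by rw [hn]; norm_num
    exact_mod_cast this
  omega

/-- **The selection skeleton is false** (translations on the circle). [cite: Furstenberg1981, Ch. 1] -/
theorem not_oneSliceSelectionSkeleton' : ¬ OneSliceSelectionSkeleton' := by
  intro h
  have hcont : Continuous (uncurry fun (s : ℝ) (x : AddCircle (1 : ℝ)) => x + (s : AddCircle (1 : ℝ))) :=
    continuous_snd.add (AddCircle.continuous_mk' (1 : ℝ) |>.comp continuous_fst)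
  obtain ⟨x, hx⟩ := h (AddCircle (1 : ℝ)) (fun s x => x + (s : AddCircle (1 : ℝ)))
    (fun s x => x + (s : AddCircle (1 : ℝ))) hcont hcont
    (fun x => by simp) (fun s t x => by rw [AddCircle.coe_add]; abel)
    (fun x => by simp) (fun s t x => by rw [AddCircle.coe_add]; abel)
    (fun x => by
      show x + ((1 : ℝ) : AddCircle (1 : ℝ)) = x
      rw [AddCircle.coe_period, add_zero])
    (fun s θ x => by abel)
  rcases hx with hφ | hρ
  · exact addCircle_one_half_ne_zero' (by simpa using hφ (1 / 2))
  · exact addCircle_one_half_ne_zero' (by simpa using hρ (1 / 2))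

/-- **The zoom flow on the scar orbit of an RSS field is periodic**: for an `α`-RSS field, rescaling
by `λ · e^{π/α}` gives (on `t < 0`) the same field as rescaling by `λ`, hence the same scar — the scar
orbit `{scar(D_λ u)}` is a circle on which the zoom flow translates, and (RSS) so do the rotations:
the concrete form of the skeleton's counterexample inside the crux. [cite: PineauVicol2026, Remark 1.5] -/
theorem sameScar_nsRescale_mul_period_of_isSpiralRSS {α : ℝ} {u : ℝ → ℝ³ → ℝ³} (h : IsSpiralRSS α u)
    {lam : ℝ} (hlam : 0 < lam) :
    SameScar (nsRescale (lam * Real.exp (Real.pi / α)) u) (nsRescale lam u) := by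
  have hfun : ∀ t < 0, ∀ x, nsRescale (lam * Real.exp (Real.pi / α)) u t x = nsRescale lam u t x := by
    intro t ht x
    have key := h.dss (lam ^ 2 * t) (mul_neg_of_pos_of_neg (by positivity) ht) (lam • x)
    rw [nsRescale_apply] at key
    have e1 : (lam * Real.exp (Real.pi / α)) ^ 2 * t = Real.exp (Real.pi / α) ^ 2 * (lam ^ 2 * t) := by
      ring
    have e2 : (lam * Real.exp (Real.pi / α)) • x = Real.exp (Real.pi / α) • (lam • x) := by
      rw [smul_smul, mul_comm]
    rw [nsRescale_apply, nsRescale_apply, e1, e2, ← key, smul_smul, smul_smul]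
  exact (sameScar_congr_left hfun).2 (sameScar_refl _)

end Skeleton

/-! ## §10 (gen 3) Remarks for the provers and the planner (paper-level, with pointers)

* SIBLING ANALYSES NOT REPEATED HERE. The `ScarRigidity` seat (`Cruxes/ScarRigidity/Disproof.lean`, gen 2)
  has (i) refuted the route's foreseen exterior lemma `LinearRellichExterior` as worded — Serrin /
  dipole POTENTIAL FLOWS `c√(−t)∇Γ`, `c(−t)∇∂ₑΓ` solve Navier–Stokes on the parabolic exterior
  `{|y| > R}` with zero scar and `O(|y|⁻³)` decay (landed `PotentialFlowParabolicExterior`,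
  `DipoleMomentFlowParabolicExterior`) —, and (ii) recorded why the route's kill criterion (i) cannot
  fire generically at the linear level: around the zero background the Stokes–Ornstein–Uhlenbeck operator
  `Δ − ½y·∇ − ½` has NO tempered eternal modes at all (spectral gap; the regular solution of the radial
  mode ODE `v'' + (2/r − r/2)v' − (½ + iμ + ℓ(ℓ+1)/r²)v = 0` is `r^ℓ M(a, ℓ+3/2, r²/4)` with
  `a = (ℓ + 1 + 2iμ)/2 ∉ −ℕ`, so it always carries the `e^{r²/4}` branch), the scar becoming decisive only
  for backgrounds carrying neutral modes.  Consequence for THIS crux: the engines "made one-slice by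
  ScarRigidity" inherit an open unique-continuation problem across a critical core, and (§8) any success
  of them that does not refute `ScarRigidity` proves the target `X` directly.
* PARABOLIC ANALOGY FOR THE OMITTED CLASS (§4). Pineau–Vicol themselves list the complex
  Ginzburg–Landau equation among the models where self-similar singularity formation is a theorem
  (arXiv:2607.09619 p. 1, footnote 1: "the complex Ginzburg–Landau equation [52, 45]"; p. 85:
  [52] = P. Plecháč, V. Šverák, *On self-similar singular solutions of the complex Ginzburg–Landau
  equation*, Comm. Pure Appl. Math. 54 (2001) 1215–1242; [45] = N. Masmoudi, H. Zaag, *Blow-up profile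
  for the complex Ginzburg–Landau equation*, J. Funct. Anal. 255 (2008) 1613–1666).  In both (recalled,
  texts not held on this hub: searchd rc 75 all session) the singular solutions are self-similar only
  UP TO THE GAUGE ROTATION — a phase turning linearly in `s = −log(T−t)`, `u ≈ (T−t)^{−(1+iδ)/(p−1)}f`,
  the `U(1)`-analogue of Perelman's RSS ansatz (1.7) —, and they are the generic/stable ones there; the
  final-time profile then carries a log-spiral phase `|x|^{−2iδ/(p−1)}` (up to logarithms), neither
  homogeneous nor gauge-invariant.  So in the nearest parabolic model where the third one-parameter
  subgroup has been analysed it is not exotic; for Navier–Stokes, P–V p. 3: "it is currently an open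
  problem to rule out nontrivial rotated backward self-similar singularities", and p. 4 names the
  obstruction (the rotation terms `α(JU − (Jy·∇)U)` destroy the head-pressure maximum principle).
  (Analogy only: the gauge `U(1)` acts freely on non-zero fields, `SO(2)` does not.)
* SMALL-CONSTANT CORNER (positive side, for a prover): for `C` below the `ε`-regularity threshold of the
  space–time Type-I class (Chae–Wolf 2017 Rmk 1.4 via Gustafson–Kang–Tsai 2007; KNSS 2009 small-`C`
  Liouville) the antecedent of the crux is EMPTY, so `SymmetricScarExists` restricted to `C < c₀` is
  provable now by the same vacuity as §2 — the only unconditional fragment of the crux in sight.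
* FULL ROTATION COVARIANCE. The crux pins the `x₃`-axis; a profile whose scar is axisymmetric about
  another axis is a witness only after conjugation by an element of `SO(3)`, which `SimilarityCovariance`
  (stmt-11720) does not provide (it gives `rotZ` only).  Harmless for truth (the apex class is
  `O(3)`-covariant), but a prover of a (b)-type line needs the `SO(3)` bookkeeping lemma first
  (also noted by the route-pass refuters and ideator 3).
-/


/-! ## §11 (gen 3) Normal forms for provers: only `C > 0` matters; `∃`-form of the crux -/

section NormalForm

/-- **A singular profile has a positive Type-I constant**: if `|u| ≤ C/(|x|+√−t)` with `C ≤ 0` then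
`u = 0` on `t < 0`, so the origin is not backward-singular. [folklore] -/
theorem pos_const_of_decay_singular {C : ℝ} {u : ℝ → ℝ³ → ℝ³} (hdec : HasTypeIDecay C u)
    (hsing : IsBackwardSingularPoint u 0) : 0 < C := by
  by_contra hC
  push Not at hC
  have hzero : ∀ t < 0, ∀ x, u t x = 0 := by
    intro t ht x
    have h := hdec t ht x
    have hden : 0 < ‖x‖ + Real.sqrt (-t) :=
      add_pos_of_nonneg_of_pos (norm_nonneg _) (Real.sqrt_pos.2 (by linarith))
    have : ‖u t x‖ ≤ 0 := h.trans (div_nonpos_of_nonpos_of_nonneg hC hden.le)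
    exact norm_le_zero_iff.1 this
  have h1 := hsing 1 one_pos
  have hae : uncurry u =ᵐ[volume.restrict (parabolicCylinder 1 (0 : ℝ × ℝ³))] 0 := by
    filter_upwards [ae_restrict_mem (isOpen_parabolicCylinder 1 (0 : ℝ × ℝ³)).measurableSet] with z hz
    rw [mem_parabolicCylinder] at hz
    exact hzero z.1 (by simpa using hz.1.2) z.2
  rw [eLpNorm_congr_ae hae, eLpNorm_zero] at h1
  exact ENNReal.zero_ne_top h1

/-- **`∃`-form of the crux**: `S ↔ ((∃ C, singular apex profile with constant C) → symmetric-scar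
witness)`. [folklore] -/
theorem symmetricScarExists_iff_exists :
    SymmetricScarExists ↔
      ((∃ (C : ℝ) (u : ℝ → ℝ³ → ℝ³) (p : ℝ → ℝ³ → ℝ) (G : ℝ → ℝ³ → ℝ³ →L[ℝ] ℝ³),
        IsSuitableWeakSolutionOn 𝕊 1 0 u p ∧ HasWeakSpatialGradientOn 𝕊 u G ∧
        typeIBound (Iio (0 : ℝ) ×ˢ univ) u p G < ⊤ ∧ HasTypeIDecay C u ∧ IsBackwardSingularPoint u 0) →
      ∃ (C' : ℝ) (u : ℝ → ℝ³ → ℝ³) (p : ℝ → ℝ³ → ℝ) (G : ℝ → ℝ³ → ℝ³ →L[ℝ] ℝ³),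
        IsSuitableWeakSolutionOn 𝕊 1 0 u p ∧ HasWeakSpatialGradientOn 𝕊 u G ∧
        typeIBound (Iio (0 : ℝ) ×ˢ univ) u p G < ⊤ ∧ HasTypeIDecay C' u ∧
        IsBackwardSingularPoint u 0 ∧ (HomScar u ∨ AxiScar u)) := by
  constructor
  · rintro hS ⟨C, hex⟩
    exact hS C hex
  · intro h C hex
    exact h ⟨C, hex⟩

/-- **Only positive constants carry content**: the crux is equivalent to its restriction to `C > 0`
(the `C ≤ 0` slices are vacuous by `pos_const_of_decay_singular`). [folklore] -/
theorem symmetricScarExists_iff_pos :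
    SymmetricScarExists ↔
      ∀ C : ℝ, 0 < C → (∃ (u : ℝ → ℝ³ → ℝ³) (p : ℝ → ℝ³ → ℝ) (G : ℝ → ℝ³ → ℝ³ →L[ℝ] ℝ³),
        IsSuitableWeakSolutionOn 𝕊 1 0 u p ∧ HasWeakSpatialGradientOn 𝕊 u G ∧
        typeIBound (Iio (0 : ℝ) ×ˢ univ) u p G < ⊤ ∧ HasTypeIDecay C u ∧ IsBackwardSingularPoint u 0) →
      ∃ (C' : ℝ) (u : ℝ → ℝ³ → ℝ³) (p : ℝ → ℝ³ → ℝ) (G : ℝ → ℝ³ → ℝ³ →L[ℝ] ℝ³),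
        IsSuitableWeakSolutionOn 𝕊 1 0 u p ∧ HasWeakSpatialGradientOn 𝕊 u G ∧
        typeIBound (Iio (0 : ℝ) ×ˢ univ) u p G < ⊤ ∧ HasTypeIDecay C' u ∧
        IsBackwardSingularPoint u 0 ∧ (HomScar u ∨ AxiScar u) := by
  constructor
  · intro hS C _ hex
    exact hS C hex
  · intro h C hex
    obtain ⟨u, p, G, hsw, hwg, hI, hdec, hsing⟩ := hex
    exact h C (pos_const_of_decay_singular hdec hsing) ⟨u, p, G, hsw, hwg, hI, hdec, hsing⟩

/-- The witness may always be taken with a POSITIVE constant as well (it is singular). [folklore] -/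
theorem symScarWitness_pos {C' : ℝ} {u : ℝ → ℝ³ → ℝ³} (hdec : HasTypeIDecay C' u)
    (hsing : IsBackwardSingularPoint u 0) : 0 < C' :=
  pos_const_of_decay_singular hdec hsing

end NormalForm

end Summit.NavierStokesRegularity.NavierStokesRegularity.Cruxes.SymmetricScarExists.Disproof
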